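import Literature.MathematicalPhysics.QuantumFieldTheory.Balaban1983to89.B4RegionCov1518
import Literature.MathematicalPhysics.QuantumFieldTheory.Balaban1983to89.B4TwoBox120

/-!
# `Balaban1983to89.B4TwoRegion120` — B4 (5.5) and (1.19)–(1.20) at `A = 0` for NESTED BLOCK UNIONS `Ω ⊂ Ω₀`
# (beyond nested rectangular parallelepipeds), by an energy comparison of the two Neumann problems

Source under audit (cell pub-balaban): T. Bałaban, *Regularity and decay of lattice Green's functions*, Commun. Math.
Phys. **89** (1983) 571–597 [`Balaban1983RegularityDecay`, "B4"], p. 572 [PDF 2] (the regions `Ω`, (1.6)), p. 573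
[PDF 3] (1.13)–(1.14), p. 574 [PDF 4] (1.19)–(1.20) and the last paragraph of Sect. 1, p. 594 [PDF 24] (5.5) and the
Theorem (5.6), (5.9), (5.10) (journal page = PDF page + 570; renders
`b2b-balaban-ref1/pages/1983-cmp89-regularity-decay/1983-cmp89-regularity-decay-p002-x2.png`, `-p003-x2.png`,
`-p004-x2.png`, `-p024-x2.png`, read as images).  A sibling of `B4TwoBox120` (nested Neumann BOXES) and of
`B4RegionCov1518` ((1.15)–(1.18) for block unions, whose HONEST SCOPE (iv) lists (1.19)–(1.20) for general regions
as not treated); no existing module is touched; nothing of B4 is asserted.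

## WHAT IS PRINTED (verbatim; `≦`, `≧` of the print written `≤`, `≥`)

p. 572: «We consider also a second division of ηZ^d into cubes of size M called big blocks. […] We consider subsets Ω
which are unions of big blocks.»; (1.6) «G_k(Ω, A) = (−Δ^{η,N}_{A,Ω} + m² + aP_k(A))^{−1}, where m² ≥ 0 and a is a
positive constant close to 1.»

p. 573: «Let us recall that for operators X defined on the unit lattice functions we define the operator X|_Λ
restricted to a subset Λ by X|_Λ = ΛXΛ, where Λ also denotes the characteristic function of the set Λ. We have
C_Λ^{(k)}(Ω, A) = ((Δ^{(k)}(Ω, A) + aL^{−2}P(A))|_Λ)^{−1}.   (1.13)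
Here Δ^{(k)}(Ω, A) is an operator of the effective Gaussian action after k renormalization transformations and can
be defined by
Δ^{(k)}(Ω, A) = a_kI − a_k²Q_k(A)G_k(Ω, A)Q_k^*(A),   (1.14)
where a_k is a constant proportional to a.»

p. 574: «Finally, for Ω ⊂ Ω₀ and
δC_Λ^{(k)}(Ω, Ω₀, A) = C_Λ^{(k)}(Ω, A) − C_Λ^{(k)}(Ω₀, A),   (1.19)
we have
|δC_Λ^{(k)}(Ω, Ω₀, A; x, x′)| ≤ c₀ exp(−δ₀(|x−x′| + dist(x, Ω^{(k)c}) + dist(x′, Ω^{(k)c}))),  x, x′∈Λ.   (1.20)»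
(the constants and `Λ` are those of «Proposition 2.3 of [1]. There exist positive constants δ₀, c₀, γ₀, γ₁ dependent
on d and M only and such that for arbitrary Λ ⊂ Ω^{(k)} = Ω∩Z^d, Λ being a sum of big blocks and for e sufficiently
small, we have …», same page) … «The fifth section will be devoted to a general theorem concerning operators on the
unit lattice Z^d. There we have abstracted some basic features of our method and we have proven a theorem which, if
applied to operators (1.14), gives another proof of Proposition 2.3.»

p. 594: «and a change of the domain Ω implies a change of the operator which can be estimated in the following way
|(Δ^{(k)}(Ω, A) − Δ^{(k)}(Ω₀, A))(x, x′)| ≤ c₀e^{−δ₀(|x−x′|+dist(x, Ω^{(k)c})+dist(x′, Ω^{(k)c}))},  Ω ⊂ Ω₀,  x, x′∈Ω^{(k)}.   (5.5)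
From these properties it follows that Proposition I.2.3 is a consequence of the following
Theorem. Let Ω ⊂ Z^d and let A be a symmetric operator defined on the space L²(Ω) of functions φ:Ω→R^N and satisfying
the following condition: there exist positive constants γ₀, c₀, δ₀ such that
A ≥ γ₀I,  |A(x, x′)| ≤ c₀e^{−δ₀|x−x′|},  x, x′∈Ω.   (5.6)»
… «If we perturb the operator A by an operator B such that the condition (5.6) is satisfied for A + B, and
additionally B has the property
|B(x, x′)| ≤ c₀e^{−δ₀(|x−x′|+dist(x, Ω^c)+dist(x′, Ω^c))},  x, x′∈Ω,   (5.9)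
then we have also
|A_Λ^{−1}(x, x′) − (A+B)_Λ^{−1}(x, x′)| ≤ c₁e^{−δ₁(|x−x′|+dist(x, Ω^c)+dist(x′, Ω^c))},  x, x′∈Λ.   (5.10)»

## WHAT THIS FILE CERTIFIES (kernel-checked, zero `sorry`, no hypotheses; the lineage is USED, not re-proved)

Setting: gauge field `A = 0` (`U ≡ 1`), dimension `d + 1`, `n ≥ 1` fine points per unit length (`η = 1/n`; in the
print `n = L^k`), window `a_k ∈ [a₋, a₊]` (`a₋ > 0`), `m² ≥ 0`; TWO NESTED FINITE SETS OF UNIT SITES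
`Ω ⊆ Ω₀ ⊂ ℤ^{d+1}` (`Finset`s, `h : Ω ⊆ Ω₀`; they ARE `Ω^{(k)} ⊆ Ω₀^{(k)}`), fine regions
`η^{-1}Ω = fineDom n Ω ⊆ fineDom n Ω₀ = η^{-1}Ω₀` (unions of unit blocks with Neumann boundary conditions = bonds
inside, `B4Prop31Zero`), the inclusion of unit sites `ι = incl h : Ω → Ω₀`, and the boundary weight
`ω(y) = dist_∞(y, Ω₀ ∖ Ω)` (`dSet (Ω₀ \ Ω)`).
* §3–§4 `QF_mono`, `Dform_self_nonneg`, `Dform_sq_le`, `Dform_self_le` — **THE ENERGY COMPARISON OF THE TWO NEUMANN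
  PROBLEMS**: with `G_k(R, 0) = (fineOpR n a_k m² (fineDom n R))⁻¹` (lattice units) and `f↑` the zero extension
  from `η^{-1}Ω` to `η^{-1}Ω₀`, the bilinear form `D(f, g) = ⟨f, G_k(Ω,0)g⟩ − ⟨f↑, G_k(Ω₀,0)g↑⟩` (`Dform`) is
  symmetric and NONNEGATIVE — the Neumann form of the larger region dominates that of the smaller one on functions
  supported in the smaller one (more bonds, more whole blocks, more mass terms: `QF_mono`), and
  `⟨g, Gg⟩ = sup_w (2⟨g, w⟩ − q(w))` (`two_dot_sub_form_le`) —, hence satisfies Cauchy–Schwarz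
  `D(f,g)² ≤ D(f,f)D(g,g)`; and `0 ≤ D(g,g) ≤ ‖g‖²/min(2,a_k)` by (1.8) at `A = 0` (`B4Lower18.lower18`).
* §5 `KeffR_sub_eq`: `Δ^{(k)}(Ω,0)(y,y′) − Δ^{(k)}(Ω₀,0)(ιy,ιy′) = −(a_k²/n^{d+1})·D(1_{B(y)}, 1_{B(y′)})` ((1.14) at
  `A = 0`, `Δ^{(k)}(Ω,0) = B4Prop31Zero.KeffR n a_k m² Ω`).
* §6–§7 `Dform_diag_le_layer` — **IMS LOCALISATION**: for `ω(y) ≥ 2`,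
  `D(1_{B(y)},1_{B(y)}) ≤ ((d+1) + a_k/2)·Σ_{x ∈ layer}(G_k(Ω,0)1_{B(y)})(x)²`, `layer` = the fine points of `η^{-1}Ω`
  whose unit block lies within sup-distance `2` of `Ω₀ ∖ Ω` (`layer2`): test the variational characterisation on `Ω₀`
  with the zero extension of `(1 − θ)·G_k(Ω,0)1_{B(y)}`, `θ` an `η`-Lipschitz, `[0,1]`-valued cutoff (`cutoff`) which is
  `≡ 1` on the sites adjacent to `η^{-1}(Ω₀ ∖ Ω)`, so that no bond of `η^{-1}Ω₀` leaving `η^{-1}Ω` is charged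
  (`QF_local`); the IMS identity (`ims_identity`) leaves the commutator `½Σ|A(x,x′)|(θ(x)−θ(x′))²u(x)²` over the layer,
  with `|∇θ|² ≤ η²` against the coupling `η^{−2}` and `≤ 1` against the block term `a_k/n^{d+1}` (`ims_row_le`).
* §8 `Dform_diag_decay`: `D(1_{B(y)},1_{B(y)}) ≤ C₁·n^{d+1}·e^{−δω(y)}` for every admissible rate `δ ∈ (0,1]`
  (`2(d+1)δ² + a_k(e^δ − 1) ≤ min(2,a_k)/2`), by the lineage's Combes–Thomas set-to-set decay of the MASSIVE fine
  Green's function (`B4RegionCov1518.green_setDecay_region_mass`) summed over the unit sites of the layer against the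
  lattice profile `B4Sect5Proof.latticeConst`; `C₁ = cDiag d a_k δ` explicit.
* §9 `keff55_region` — **(5.5) AT `A = 0` FOR NESTED FINITE SETS OF UNIT SITES**: there are `δ, c > 0` depending on
  `d` and the window only (`δ = ctRate d a₋ a₊/4`) such that for all `n ≥ 1`, all `a_k ∈ [a₋,a₊]`, all `m² ≥ 0`, ALL
  nested pairs `Ω ⊆ Ω₀` and all `y, y′ ∈ Ω`:
  `|Δ^{(k)}(Ω,0)(y,y′) − Δ^{(k)}(Ω₀,0)(ιy,ιy′)| ≤ c·exp(−δ(|y − y′|_∞ + ω(y) + ω(y′)))` (Cauchy–Schwarz in `D`,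
  `e^{−δ(ω(y)+ω(y′))/2}`, interpolated with the pairing bound `B4RegionCov1518.blockPairing_bound`, `e^{−δ|y−y′|}`;
  `keff55_region_rate` is the version at a fixed admissible rate with an explicit constant).
* §10 `cov120_region_sub_delta` — **(1.19)–(1.20) AT `A = 0` FOR NESTED BLOCK UNIONS**: with `L = ℓ + 1 ≥ 2`, `Ω ⊆ Ω₀`
  finite unions of `L`-blocks of unit sites (`B4Lower18.IsBlockUnion (ℓ+1)`) and the window extended by
  `m² ∈ [0, m²₊]`, `a ∈ [a₂₋, a₂₊]` (`a₂₋ > 0`): there are `δ, c > 0` such that for all `n ≥ 1`, all such nested pairs,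
  EVERY injection `e : m → Ω` (every `Λ ⊆ Ω^{(k)}`, `e` = the inclusion) and all `i, i′ : m`:
  `|C_Λ^{(k)}(Ω; eᵢ, eᵢ′) − C_Λ^{(k)}(Ω₀; eᵢ, eᵢ′)| ≤ c·exp(−δ(|eᵢ − eᵢ′|_∞ + ω(eᵢ) + ω(eᵢ′)))`, with
  `C_Λ^{(k)}(Ω) = ((Δ^{(k)}(Ω,0) + aL^{−2}P(0))|_Λ)^{−1} = (covRSub n L a_k a m² Ω e)⁻¹` and
  `C_Λ^{(k)}(Ω₀) = (covRSub n L a_k a m² Ω₀ (ι ∘ e))⁻¹` (`B4RegionCov1518`); corollaries `cov120_region_delta`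
  (`Λ = Ω^{(k)}`), `cov120_region_finset_delta` (`Λ` a `Finset`) and an `example` at `d + 1 = 4`, `L = 2`.  Proof = THE
  PRINT'S ROUTE (p. 594): in the Section 5 Theorem take the unit-lattice set `Ω^{(k)}`,
  `A := (Δ^{(k)}(Ω₀,0) + aL^{−2}P(0))|_{Ω^{(k)}}` and `A + B := Δ^{(k)}(Ω,0) + aL^{−2}P(0)`; the `P`-parts agree because
  the entries of `P(0)` only depend on the two sites (`projL_submatrix_incl`, `covR_submatrix_incl`), so
  `B = Δ^{(k)}(Ω,0) − Δ^{(k)}(Ω₀,0)|_{Ω^{(k)}}` satisfies (5.9) with `ω` by `keff55_region` = (5.5); condition (5.6) for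
  `A` and `A + B` is `B4RegionCov1518.covR_hyp56` (with `B4Sect5Torus.hyp56_submatrix` for the compression and
  `rhoS_incl`); the conclusion (5.10) is `B4Sect5Torus.perturb_bound` (kernel-proved in the lineage), giving
  `δ = rate(K, γ₀, c₁, δ₀)/4`, `c = bigC + 1` with `c₁ = c₀ + c_K + 1`, `δ₀ = min(κ, δ_K)` (`B4TwoBox120.hyp56_weaken`).

## DICTIONARY (typist's; each line is a reading, not a quotation)

* `Ω ⊂ Ω₀` ↔ two nested finite sets of unit sites `Ω ⊆ Ω₀` (`Finset (Fin (d+1) → ℤ)`), i.e. `Ω^{(k)} ⊆ Ω₀^{(k)}`, with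
  fine regions `η^{-1}Ω = fineDom n Ω ⊆ fineDom n Ω₀` (`fineDom_mono`); in §10 both are unions of `L`-blocks
  («unions of big blocks»: the case `L ∣ M`, as in `B4RegionCov1518`); `ι = incl h` is the inclusion `Ω^{(k)} ⊂ Ω₀^{(k)}`.
* `G_k(Ω, 0) = (fineOpR …)⁻¹`, `Q_k ↔ indR`, `Δ^{(k)}(Ω, 0) = KeffR`, `P(0) = projL`,
  `Δ^{(k)}(Ω,0) + aL^{−2}P(0) = covR`, `X|_Λ = covRSub … e`, `|y − y′| = supNorm (y − y′)` (`rhoS`): exactly as in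
  `B4RegionCov1518` / `B4Prop31Zero` (their DICTIONARY); `C_Λ^{(k)}(Ω₀, A)` for `Λ ⊂ Ω^{(k)} ⊂ Ω₀^{(k)}` ↔
  `(covRSub … Ω₀ (ι ∘ e))⁻¹` (the operator of `Ω₀` compressed to `Λ`); `δC_Λ^{(k)}(Ω, Ω₀; x, x′)` (1.19) ↔
  `(covRSub … Ω e)⁻¹ i i′ − (covRSub … Ω₀ (ι ∘ e))⁻¹ i i′`.
* `dist(x, Ω^{(k)c})` in (1.20)/(5.5) ↔ `dSet (Ω₀ \ Ω) x = inf{|x − v|_∞ : v ∈ Ω₀^{(k)} ∖ Ω^{(k)}}` (`= sInf ∅ = 0` if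
  `Ω = Ω₀`).  For `Ω ⊊ Ω₀` (so `Ω₀^{(k)} ∖ Ω^{(k)} ≠ ∅`), since `Ω₀^{(k)} ∖ Ω^{(k)} ⊆ Ω^{(k)c}`,
  `dSet (Ω₀ \ Ω) ≥ dist_∞(·, Ω^{(k)c})`, so each certified bound implies the same bound with the printed
  `dist(·, Ω^{(k)c})` in the sup-norm reading; for `Ω = Ω₀` the weight is the junk value `0` but the two Green's
  functions coincide and `δC ≡ 0`, so the printed shape holds trivially (spelled out in `B4Prop23ZeroRegion.covRSub_incl_eq`).
* `1_{B(y)}` ↔ `blockInd n Ω y` (a row of `indR`); `D` ↔ `Dform`; `θ` ↔ `cutoff n (outerFine n Ω Ω₀)`; the boundary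
  layer ↔ `layer2 n Ω Ω₀`; `q_R` (the Neumann form of `fineOpR … R`) ↔ `QF n a_k m² R` on zero-extended functions.

## HONEST SCOPE (what is NOT certified)

* `A = 0` only («for e sufficiently small», the regularity theory of B4 §§2–4 for `A ≠ 0`, is absent).  (5.5) (§9)
  is certified for arbitrary nested finite sets of unit sites; (1.19)–(1.20) (§10) for nested finite unions of
  `L`-blocks (needed by (1.15)); nothing for infinite regions; (5.4)/(5.6) are not re-typed (`B4RegionCov1518`).
* `Ω^{(k)c}` is READ as `Ω₀^{(k)} ∖ Ω^{(k)}` (DICTIONARY; the certified statements are the stronger ones); distances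
  are sup-norm; only EXISTENCE of the constants is printed and certified — they are not the print's `c₀, δ₀` of
  Proposition 2.3, they depend on `d` (§9) resp. `d`, `ℓ` (§10) AND the window (print: «dependent on d and M only»),
  and nothing is claimed about their size or about uniformity in `L`.
* In §10 `Λ` is an ARBITRARY subset of `Ω^{(k)}` (the range of an injection) — more than «Λ being a sum of big blocks»
  asks, harmless at `A = 0` and NOT claimed for `A ≠ 0`.
* The proof of (5.5) is the typist's (energy comparison of the two Neumann problems + IMS localisation + the
  Combes–Thomas bound of `CombesThomas1973` kernel-proved in the lineage), NOT the paper's (the paper states (5.5) at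
  p. 594 without proof at that point, «… which can be estimated in the following way»); the route (5.5) + (5.6) +
  Theorem (5.10) ⇒ (1.20) IS the print's («From these properties it follows that Proposition I.2.3 is a consequence
  of the following Theorem»), with the Theorem kernel-proved in `B4Sect5Torus`.  `B4TwoBox120` (nested boxes, via
  the boundary-bond resolvent identity and (2.35)) is neither used nor superseded; the present route needs no
  regularity / derivative bound, which is why it reaches general block unions.
* Nothing is inferred from the manuscript: every step is kernel-checked from the definitions; the quoted sentences
  locate the statements, they are not used as hypotheses.  `DagBinding` / `DagDischarged` / the typed
  `B4.Prop23Printed` are not edited or instantiated (one writer).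

Value = kernel certificate of (5.5) and (1.19)–(1.20) at `A = 0` for nested block unions (the print's Section-5
route, with an elementary energy-comparison proof of (5.5)); NOT summit progress.
-/

namespace Literature.MathematicalPhysics.QuantumFieldTheory.Balaban1983to89.B4TwoRegion120

open Finset Matrix
open Literature.MathematicalPhysics.QuantumFieldTheory.Balaban1983to89.B4ContourShift (supNorm supNorm_nonneg
  abs_le_supNorm exists_supNorm_eq)
open Literature.MathematicalPhysics.QuantumFieldTheory.Balaban1983to89.B4Reflection242
open Literature.MathematicalPhysics.QuantumFieldTheory.Balaban1983to89.B4Green242Bridge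
open Literature.MathematicalPhysics.QuantumFieldTheory.Balaban1983to89.B4BoxCov237
open Literature.MathematicalPhysics.QuantumFieldTheory.Balaban1983to89.B4Lower18
open Literature.MathematicalPhysics.QuantumFieldTheory.Balaban1983to89.B4Prop31Zero
open Literature.MathematicalPhysics.QuantumFieldTheory.Balaban1983to89.B4RegionCov1518
open B4Green244 (finePt)
open B4Sect5Torus (IsPseudoDist SumBound Hyp56 Hyp59 rate rate_pos bigC bigC_nonneg hyp56_submatrix perturb_bound)
open B4Sect5Proof (latticeConst latticeConst_nonneg latticeSum_le)

noncomputable section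

variable {d : ℕ}

/-! ## §1  Quadratic-form algebra of a symmetric real matrix: completing the square, the IMS localisation
identity, Cauchy–Schwarz for a positive form -/

section Algebra

variable {ι : Type*} [Fintype ι]

/-- `⟨u − v, A(u − v)⟩ = ⟨u, Au⟩ − 2⟨v, Au⟩ + ⟨v, Av⟩` for symmetric `A`. [folklore] -/
theorem form_sub {A : Matrix ι ι ℝ} (hA : A.IsSymm) (u v : ι → ℝ) :
    (u - v) ⬝ᵥ A *ᵥ (u - v) = u ⬝ᵥ A *ᵥ u - 2 * (v ⬝ᵥ A *ᵥ u) + v ⬝ᵥ A *ᵥ v := by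
  have huv : u ⬝ᵥ A *ᵥ v = v ⬝ᵥ A *ᵥ u := by
    rw [← Matrix.dotProduct_transpose_mulVec A u v, hA.eq]
  rw [Matrix.mulVec_sub, sub_dotProduct, dotProduct_sub, dotProduct_sub, huv]
  ring

/-- **COMPLETING THE SQUARE**: for a positive symmetric `A` with `Aw = g`, `2⟨g, v⟩ − ⟨v, Av⟩ ≤ ⟨g, w⟩`
(`= ⟨g, A⁻¹g⟩`) for every trial vector `v` — the variational characterisation of the inverse form. [folklore] -/
theorem two_dot_sub_form_le {A : Matrix ι ι ℝ} (hA : A.IsSymm) (hpsd : ∀ w, 0 ≤ w ⬝ᵥ A *ᵥ w)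
    {w g : ι → ℝ} (hw : A *ᵥ w = g) (v : ι → ℝ) : 2 * (g ⬝ᵥ v) - v ⬝ᵥ A *ᵥ v ≤ g ⬝ᵥ w := by
  have h := hpsd (v - w)
  rw [form_sub hA v w] at h
  have h1 : w ⬝ᵥ A *ᵥ v = g ⬝ᵥ v := by
    rw [← Matrix.dotProduct_transpose_mulVec A v w, hA.eq, hw, dotProduct_comm]
  have h2 : w ⬝ᵥ A *ᵥ w = g ⬝ᵥ w := by rw [hw, dotProduct_comm]
  linarith

/-- **THE INVERSE FORM UNDER COERCIVITY**: `c‖w‖² ≤ ⟨w, Aw⟩` for all `w` and `Aw = g` give `⟨g, w⟩ ≤ ‖g‖²/c`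
(`⟨g, A⁻¹g⟩ ≤ c⁻¹‖g‖²`). [folklore] -/
theorem inv_form_le {A : Matrix ι ι ℝ} {c : ℝ} (hc : 0 < c) (hcoer : ∀ w, c * (w ⬝ᵥ w) ≤ w ⬝ᵥ A *ᵥ w)
    {w g : ι → ℝ} (hw : A *ᵥ w = g) : g ⬝ᵥ w ≤ (g ⬝ᵥ g) / c := by
  have h1 : c * (w ⬝ᵥ w) ≤ g ⬝ᵥ w := by
    have := hcoer w
    rw [hw] at this
    rwa [dotProduct_comm w g] at this
  have h2 : (g ⬝ᵥ w) ^ 2 ≤ (g ⬝ᵥ g) * (w ⬝ᵥ w) := by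
    simpa only [dotProduct, pow_two] using Finset.sum_mul_sq_le_sq_mul_sq Finset.univ g w
  have h0 : 0 ≤ g ⬝ᵥ g := Finset.sum_nonneg fun i _ => mul_self_nonneg (g i)
  have hww : 0 ≤ w ⬝ᵥ w := Finset.sum_nonneg fun i _ => mul_self_nonneg (w i)
  rw [le_div_iff₀ hc]
  by_cases hpos : 0 < g ⬝ᵥ w
  · nlinarith [mul_le_mul_of_nonneg_left h2 hc.le, mul_le_mul_of_nonneg_left h1 h0, hpos]
  · push Not at hpos
    nlinarith [h0]

/-- **THE IMS LOCALISATION IDENTITY** for a symmetric matrix and a multiplier `θ`: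
`⟨θu, A(θu)⟩ − ⟨θ²u, Au⟩ = −½ Σ_{x,x′} A(x,x′)(θ(x) − θ(x′))² u(x)u(x′)`. [folklore] -/
theorem ims_identity {A : Matrix ι ι ℝ} (hA : A.IsSymm) (θ u : ι → ℝ) :
    (fun x => θ x * u x) ⬝ᵥ A *ᵥ (fun x => θ x * u x) - (fun x => θ x ^ 2 * u x) ⬝ᵥ A *ᵥ u
      = -(1 / 2) * ∑ x, ∑ y, A x y * (θ x - θ y) ^ 2 * (u x * u y) := by
  have e1 : (fun x => θ x * u x) ⬝ᵥ A *ᵥ (fun x => θ x * u x)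
      = ∑ x, ∑ y, θ x * u x * (A x y * (θ y * u y)) := by
    simp only [dotProduct, Matrix.mulVec, Finset.mul_sum]
  have e2 : (fun x => θ x ^ 2 * u x) ⬝ᵥ A *ᵥ u = ∑ x, ∑ y, θ x ^ 2 * u x * (A x y * u y) := by
    simp only [dotProduct, Matrix.mulVec, Finset.mul_sum]
  have key : ∑ x, ∑ y, A x y * θ x ^ 2 * (u x * u y) = ∑ x, ∑ y, A x y * θ y ^ 2 * (u x * u y) := by
    rw [Finset.sum_comm]
    refine Finset.sum_congr rfl fun x _ => Finset.sum_congr rfl fun y _ => ?_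
    rw [hA.apply y x]
    ring
  have e3 : ∑ x, ∑ y, θ x * u x * (A x y * (θ y * u y)) - ∑ x, ∑ y, θ x ^ 2 * u x * (A x y * u y)
      + (1 / 2) * ∑ x, ∑ y, A x y * (θ x - θ y) ^ 2 * (u x * u y)
      = (1 / 2) * ∑ x, ∑ y, A x y * θ y ^ 2 * (u x * u y)
        - (1 / 2) * ∑ x, ∑ y, A x y * θ x ^ 2 * (u x * u y) := by
    rw [Finset.mul_sum, Finset.mul_sum, Finset.mul_sum, ← Finset.sum_sub_distrib, ← Finset.sum_add_distrib,
      ← Finset.sum_sub_distrib]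
    refine Finset.sum_congr rfl fun x _ => ?_
    rw [Finset.mul_sum, Finset.mul_sum, Finset.mul_sum, ← Finset.sum_sub_distrib, ← Finset.sum_add_distrib,
      ← Finset.sum_sub_distrib]
    refine Finset.sum_congr rfl fun y _ => ?_
    ring
  rw [e1, e2]
  rw [key] at e3
  linarith

/-- the absolute IMS error: `|Σ_{x,x′} A(x,x′)(θ(x) − θ(x′))²u(x)u(x′)| ≤ Σ_x u(x)² Σ_{x′} |A(x,x′)|(θ(x) − θ(x′))²`
(`2|uu′| ≤ u² + u′²` and symmetry). [folklore] -/
theorem ims_abs_le {A : Matrix ι ι ℝ} (hA : A.IsSymm) (θ u : ι → ℝ) :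
    |∑ x, ∑ y, A x y * (θ x - θ y) ^ 2 * (u x * u y)| ≤ ∑ x, u x ^ 2 * ∑ y, |A x y| * (θ x - θ y) ^ 2 := by
  have h1 : |∑ x, ∑ y, A x y * (θ x - θ y) ^ 2 * (u x * u y)|
      ≤ ∑ x, ∑ y, |A x y| * (θ x - θ y) ^ 2 * ((u x ^ 2 + u y ^ 2) / 2) := by
    refine (Finset.abs_sum_le_sum_abs _ _).trans (Finset.sum_le_sum fun x _ => ?_)
    refine (Finset.abs_sum_le_sum_abs _ _).trans (Finset.sum_le_sum fun y _ => ?_)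
    rw [abs_mul, abs_mul, abs_of_nonneg (sq_nonneg (θ x - θ y))]
    refine mul_le_mul_of_nonneg_left ?_ (by positivity)
    rw [abs_mul]
    nlinarith [sq_nonneg (|u x| - |u y|), sq_abs (u x), sq_abs (u y), abs_nonneg (u x), abs_nonneg (u y)]
  have h2 : ∑ x, ∑ y, |A x y| * (θ x - θ y) ^ 2 * ((u x ^ 2 + u y ^ 2) / 2)
      = (1 / 2) * ∑ x, ∑ y, |A x y| * (θ x - θ y) ^ 2 * u x ^ 2
        + (1 / 2) * ∑ x, ∑ y, |A x y| * (θ x - θ y) ^ 2 * u y ^ 2 := by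
    rw [Finset.mul_sum, Finset.mul_sum, ← Finset.sum_add_distrib]
    refine Finset.sum_congr rfl fun x _ => ?_
    rw [Finset.mul_sum, Finset.mul_sum, ← Finset.sum_add_distrib]
    refine Finset.sum_congr rfl fun y _ => ?_
    ring
  have h3 : ∑ x, ∑ y, |A x y| * (θ x - θ y) ^ 2 * u y ^ 2 = ∑ x, ∑ y, |A x y| * (θ x - θ y) ^ 2 * u x ^ 2 := by
    rw [Finset.sum_comm]
    refine Finset.sum_congr rfl fun x _ => Finset.sum_congr rfl fun y _ => ?_
    rw [hA.apply x y]
    ring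
  have h4 : ∑ x, ∑ y, |A x y| * (θ x - θ y) ^ 2 * u x ^ 2 = ∑ x, u x ^ 2 * ∑ y, |A x y| * (θ x - θ y) ^ 2 := by
    refine Finset.sum_congr rfl fun x _ => ?_
    rw [Finset.mul_sum]
    exact Finset.sum_congr rfl fun y _ => by ring
  rw [h2, h3, h4] at h1
  linarith

/-- **CAUCHY–SCHWARZ FOR A POSITIVE SYMMETRIC FORM**: `⟨f, Mg⟩² ≤ ⟨f, Mf⟩⟨g, Mg⟩`. [folklore] -/
theorem dot_sq_le_of_psd {M : Matrix ι ι ℝ} (hM : M.IsSymm) (hpsd : ∀ w, 0 ≤ w ⬝ᵥ M *ᵥ w) (f g : ι → ℝ) :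
    (f ⬝ᵥ M *ᵥ g) ^ 2 ≤ (f ⬝ᵥ M *ᵥ f) * (g ⬝ᵥ M *ᵥ g) := by
  have h : ∀ t : ℝ, 0 ≤ (g ⬝ᵥ M *ᵥ g) * (t * t) + (2 * (f ⬝ᵥ M *ᵥ g)) * t + f ⬝ᵥ M *ᵥ f := by
    intro t
    have e : (f + t • g) ⬝ᵥ M *ᵥ (f + t • g)
        = (g ⬝ᵥ M *ᵥ g) * (t * t) + (2 * (f ⬝ᵥ M *ᵥ g)) * t + f ⬝ᵥ M *ᵥ f := by
      simp only [Matrix.mulVec_add, Matrix.mulVec_smul, add_dotProduct, dotProduct_add, smul_dotProduct,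
        dotProduct_smul, smul_eq_mul]
      have hgf : g ⬝ᵥ M *ᵥ f = f ⬝ᵥ M *ᵥ g := by
        rw [← Matrix.dotProduct_transpose_mulVec M g f, hM.eq]
      rw [hgf]
      ring
    rw [← e]
    exact hpsd _
  have hd := discrim_le_zero h
  rw [discrim] at hd
  nlinarith [hd]

end Algebra

/-! ## §2  Nested finite sets of sites: the inclusion, extension by zero, compressions along the inclusion -/

section Nested

variable {R R₀ : Finset (Fin (d + 1) → ℤ)}

/-- the inclusion `R ↪ R₀` of nested finite sets of sites. [folklore] -/
def incl (h : R ⊆ R₀) (x : ↥R) : ↥R₀ := ⟨x.1, h x.2⟩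

/-- the inclusion does not change the underlying site. [folklore] -/
@[simp] theorem incl_val (h : R ⊆ R₀) (x : ↥R) : (incl h x).1 = x.1 := rfl

/-- the inclusion is injective. [folklore] -/
theorem incl_injective (h : R ⊆ R₀) : Function.Injective (incl h) := by
  intro x y hxy
  exact Subtype.ext (by simpa [incl] using congrArg Subtype.val hxy)

/-- `incl x = incl y ↔ x = y`. [folklore] -/
theorem incl_eq_iff (h : R ⊆ R₀) (x y : ↥R) : incl h x = incl h y ↔ x = y :=
  (incl_injective h).eq_iff

/-- a sum over `R₀` of a function vanishing off `R` is the sum over `R`. [folklore] -/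
theorem sum_incl (h : R ⊆ R₀) (φ : ↥R₀ → ℝ) (hφ : ∀ z : ↥R₀, z.1 ∉ R → φ z = 0) :
    ∑ z, φ z = ∑ x : ↥R, φ (incl h x) := by
  rw [← Finset.sum_image (f := φ) (s := Finset.univ) (g := incl h)
    (fun x _ y _ hxy => incl_injective h hxy)]
  symm
  refine Finset.sum_subset (Finset.subset_univ _) fun z _ hz => hφ z fun hzR => hz ?_
  exact Finset.mem_image.2 ⟨⟨z.1, hzR⟩, Finset.mem_univ _, Subtype.ext rfl⟩

/-- `Σ_{z ∈ R₀} g↑(z)F(z) = Σ_{x ∈ R} g(x)F(x)` for the zero extension `g↑` of `g : R → ℝ`. [folklore] -/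
theorem sum_extS_mul (h : R ⊆ R₀) (g : ↥R → ℝ) (F : ↥R₀ → ℝ) :
    ∑ z : ↥R₀, extS R g z.1 * F z = ∑ x : ↥R, g x * F (incl h x) := by
  rw [sum_incl h (fun z => extS R g z.1 * F z) (fun z hz => by simp [extS, hz])]
  refine Finset.sum_congr rfl fun x _ => ?_
  simp only [incl_val, extS_coe]

/-- the compression of a matrix on `R₀` along the inclusion acts as the matrix on zero extensions. [folklore] -/
theorem submatrix_incl_mulVec (h : R ⊆ R₀) (G₀ : Matrix ↥R₀ ↥R₀ ℝ) (g : ↥R → ℝ) (x : ↥R) :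
    (G₀.submatrix (incl h) (incl h) *ᵥ g) x = (G₀ *ᵥ fun z => extS R g z.1) (incl h x) := by
  simp only [Matrix.mulVec, dotProduct, Matrix.submatrix_apply]
  rw [sum_incl h (fun z => G₀ (incl h x) z * extS R g z.1) (fun z hz => by simp [extS, hz])]
  refine Finset.sum_congr rfl fun x' _ => ?_
  simp only [incl_val, extS_coe]

/-- `⟨g, (G₀|_R)g′⟩ = ⟨g↑, G₀g′↑⟩`: the form of the compression is the form of `G₀` on zero extensions.
[folklore] -/
theorem dot_submatrix_incl (h : R ⊆ R₀) (G₀ : Matrix ↥R₀ ↥R₀ ℝ) (g g' : ↥R → ℝ) :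
    g ⬝ᵥ G₀.submatrix (incl h) (incl h) *ᵥ g'
      = (fun z : ↥R₀ => extS R g z.1) ⬝ᵥ G₀ *ᵥ (fun z => extS R g' z.1) := by
  simp only [dotProduct]
  rw [sum_extS_mul h g (G₀ *ᵥ fun z => extS R g' z.1)]
  refine Finset.sum_congr rfl fun x _ => ?_
  rw [submatrix_incl_mulVec h G₀ g' x]

/-- extending by zero in two steps is extending by zero. [folklore] -/
theorem extS_extS (h : R ⊆ R₀) (g : ↥R → ℝ) : extS R₀ (fun z : ↥R₀ => extS R g z.1) = extS R g := by
  funext z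
  by_cases hz : z ∈ R₀
  · rw [extS_of_mem _ hz]
  · have hzR : z ∉ R := fun h' => hz (h h')
    simp [extS, hz, hzR]

/-- restriction followed by zero extension agrees with the function on the smaller set. [folklore] -/
theorem extS_comp_incl (h : R ⊆ R₀) (U : ↥R₀ → ℝ) {z : Fin (d + 1) → ℤ} (hz : z ∈ R) :
    extS R (U ∘ incl h) z = extS R₀ U z := by
  rw [extS_of_mem _ hz, extS_of_mem _ (h hz)]
  rfl

end Nested

/-! ## §3  The quadratic form of `−Δ^{η,N}_Ω + m² + a_kP_k(0)` as an explicit function of the zero extension: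
monotonicity in the region and locality -/

section Form

variable {R R₀ : Finset (Fin (d + 1) → ℤ)}

/-- the quadratic form (1.3)–(1.6) of the region `R` evaluated on a lattice function `w` (only `w|_R` enters):
`(n²/2)Σ_{x,y ∈ R, y ∼ x}(w(x) − w(y))² + (a/n^{d+1})Σ_{blocks b of R}(Σ_{x ∈ b}w(x))² + m²Σ_{x∈R}w(x)²`.
[cite: Balaban1983RegularityDecay, p. 572 (1.3)–(1.6), dictionary] [folklore] -/
def QF (n : ℕ) (a m2 : ℝ) (R : Finset (Fin (d + 1) → ℤ)) (w : (Fin (d + 1) → ℤ) → ℝ) : ℝ :=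
  (n : ℝ) ^ 2 / 2 * (∑ x ∈ R, ∑ y ∈ R, if y ∈ nbrs x then (w x - w y) ^ 2 else 0)
    + a * ((n : ℝ) ^ (d + 1))⁻¹
        * ∑ b ∈ R.image (blk n), (∑ x ∈ R.filter (fun x => blk n x = b), w x) ^ 2
    + m2 * ∑ x ∈ R, w x ^ 2

/-- `⟨g, (−Δ^{η,N}_R + m² + aP_k)g⟩ = QF(g↑)` (`B4Lower18.fineOpR_form` rewritten on the zero extension). [folklore] -/
theorem form_eq_QF {n : ℕ} (hn : 1 ≤ n) (hR : IsBlockUnion n R) (a m2 : ℝ) (g : ↥R → ℝ) :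
    g ⬝ᵥ fineOpR n a m2 R *ᵥ g = QF n a m2 R (extS R g) := by
  rw [fineOpR_form hn hR a m2 g, QF]
  have h1 : (∑ x : ↥R, ∑ y : ↥R, if y.1 ∈ nbrs x.1 then (g x - g y) ^ 2 else 0)
      = ∑ x ∈ R, ∑ y ∈ R, if y ∈ nbrs x then (extS R g x - extS R g y) ^ 2 else 0 := by
    calc (∑ x : ↥R, ∑ y : ↥R, if y.1 ∈ nbrs x.1 then (g x - g y) ^ 2 else 0)
        = ∑ x : ↥R, ∑ y : ↥R, (if y.1 ∈ nbrs x.1 then (extS R g x.1 - extS R g y.1) ^ 2 else 0) := by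
          simp only [extS_coe]
      _ = ∑ x : ↥R, ∑ y ∈ R, (if y ∈ nbrs x.1 then (extS R g x.1 - extS R g y) ^ 2 else 0) :=
          Finset.sum_congr rfl fun x _ =>
            Finset.sum_coe_sort R (fun y => if y ∈ nbrs x.1 then (extS R g x.1 - extS R g y) ^ 2 else 0)
      _ = _ := Finset.sum_coe_sort R
            (fun x => ∑ y ∈ R, if y ∈ nbrs x then (extS R g x - extS R g y) ^ 2 else 0)
  have h2 : ∀ b : ↥(R.image (blk n)),
      ∑ x ∈ Finset.univ.filter (fun x : ↥R => rblk n R x = b), g x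
        = ∑ x ∈ R.filter (fun x => blk n x = b.1), extS R g x := by
    intro b
    rw [Finset.sum_filter, Finset.sum_filter]
    calc (∑ x : ↥R, if rblk n R x = b then g x else 0)
        = ∑ x : ↥R, (if blk n x.1 = b.1 then extS R g x.1 else 0) := by
          refine Finset.sum_congr rfl fun x _ => ?_
          have : (rblk n R x = b) ↔ (blk n x.1 = b.1) := by
            rw [Subtype.ext_iff]
            rfl
          simp only [this, extS_coe]
      _ = _ := Finset.sum_coe_sort R (fun x => if blk n x = b.1 then extS R g x else 0)
  have h3 : ∑ b : ↥(R.image (blk n)), (∑ x ∈ Finset.univ.filter (fun x : ↥R => rblk n R x = b), g x) ^ 2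
      = ∑ b ∈ R.image (blk n), (∑ x ∈ R.filter (fun x => blk n x = b), extS R g x) ^ 2 := by
    calc _ = ∑ b : ↥(R.image (blk n)), (∑ x ∈ R.filter (fun x => blk n x = b.1), extS R g x) ^ 2 :=
          Finset.sum_congr rfl fun b _ => by rw [h2 b]
      _ = _ := Finset.sum_coe_sort (R.image (blk n))
            (fun b => (∑ x ∈ R.filter (fun x => blk n x = b), extS R g x) ^ 2)
  have h4 : g ⬝ᵥ g = ∑ x ∈ R, extS R g x ^ 2 := by
    calc g ⬝ᵥ g = ∑ x : ↥R, extS R g x.1 ^ 2 := by simp only [dotProduct, extS_coe, pow_two]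
      _ = _ := Finset.sum_coe_sort R (fun x => extS R g x ^ 2)
  rw [h1, h3, h4]

/-- `QF` only sees the values on `R`. [folklore] -/
theorem QF_congr {n : ℕ} {a m2 : ℝ} {w w' : (Fin (d + 1) → ℤ) → ℝ} (hw : ∀ z ∈ R, w z = w' z) :
    QF n a m2 R w = QF n a m2 R w' := by
  unfold QF
  have E1 : (∑ x ∈ R, ∑ y ∈ R, if y ∈ nbrs x then (w x - w y) ^ 2 else 0)
      = ∑ x ∈ R, ∑ y ∈ R, if y ∈ nbrs x then (w' x - w' y) ^ 2 else 0 :=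
    Finset.sum_congr rfl fun x hx => Finset.sum_congr rfl fun y hy => by rw [hw x hx, hw y hy]
  have E2 : ∑ b ∈ R.image (blk n), (∑ x ∈ R.filter (fun x => blk n x = b), w x) ^ 2
      = ∑ b ∈ R.image (blk n), (∑ x ∈ R.filter (fun x => blk n x = b), w' x) ^ 2 :=
    Finset.sum_congr rfl fun b _ => by
      rw [Finset.sum_congr rfl fun x hx => hw x (Finset.mem_filter.1 hx).1]
  have E3 : ∑ x ∈ R, w x ^ 2 = ∑ x ∈ R, w' x ^ 2 := Finset.sum_congr rfl fun x hx => by rw [hw x hx]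
  rw [E1, E2, E3]

/-- **MONOTONICITY OF THE NEUMANN FORM IN THE REGION**: for a union `R` of blocks inside `R₀` and `a, m² ≥ 0`,
`QF_R(w) ≤ QF_{R₀}(w)` — every bond, block and site of `R` is one of `R₀` (Neumann b.c.: no boundary term).
[folklore] -/
theorem QF_mono {n : ℕ} (hR : IsBlockUnion n R) (hsub : R ⊆ R₀) {a m2 : ℝ} (ha : 0 ≤ a) (hm : 0 ≤ m2)
    (w : (Fin (d + 1) → ℤ) → ℝ) : QF n a m2 R w ≤ QF n a m2 R₀ w := by
  unfold QF
  have hn2 : 0 ≤ (n : ℝ) ^ 2 / 2 := by positivity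
  have ha' : 0 ≤ a * ((n : ℝ) ^ (d + 1))⁻¹ := by positivity
  have l1 : (∑ x ∈ R, ∑ y ∈ R, if y ∈ nbrs x then (w x - w y) ^ 2 else 0)
      ≤ ∑ x ∈ R₀, ∑ y ∈ R₀, if y ∈ nbrs x then (w x - w y) ^ 2 else 0 := by
    calc (∑ x ∈ R, ∑ y ∈ R, if y ∈ nbrs x then (w x - w y) ^ 2 else 0)
        ≤ ∑ x ∈ R, ∑ y ∈ R₀, (if y ∈ nbrs x then (w x - w y) ^ 2 else 0) :=
          Finset.sum_le_sum fun x _ =>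
            Finset.sum_le_sum_of_subset_of_nonneg hsub fun y _ _ => by split_ifs <;> positivity
      _ ≤ _ := Finset.sum_le_sum_of_subset_of_nonneg hsub fun x _ _ =>
            Finset.sum_nonneg fun y _ => by split_ifs <;> positivity
  have l2 : ∑ b ∈ R.image (blk n), (∑ x ∈ R.filter (fun x => blk n x = b), w x) ^ 2
      ≤ ∑ b ∈ R₀.image (blk n), (∑ x ∈ R₀.filter (fun x => blk n x = b), w x) ^ 2 := by
    have hfil : ∀ b ∈ R.image (blk n),
        R.filter (fun x => blk n x = b) = R₀.filter (fun x => blk n x = b) := by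
      intro b hb
      obtain ⟨x₀, hx₀, rfl⟩ := Finset.mem_image.1 hb
      ext z
      simp only [Finset.mem_filter]
      exact ⟨fun hz => ⟨hsub hz.1, hz.2⟩, fun hz => ⟨hR hx₀ hz.2, hz.2⟩⟩
    calc _ = ∑ b ∈ R.image (blk n), (∑ x ∈ R₀.filter (fun x => blk n x = b), w x) ^ 2 :=
          Finset.sum_congr rfl fun b hb => by rw [hfil b hb]
      _ ≤ _ := Finset.sum_le_sum_of_subset_of_nonneg (Finset.image_subset_image hsub)
            fun b _ _ => sq_nonneg _
  have l3 : ∑ x ∈ R, w x ^ 2 ≤ ∑ x ∈ R₀, w x ^ 2 :=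
    Finset.sum_le_sum_of_subset_of_nonneg hsub fun x _ _ => sq_nonneg _
  have m1 := mul_le_mul_of_nonneg_left l1 hn2
  have m2' := mul_le_mul_of_nonneg_left l2 ha'
  have m3 := mul_le_mul_of_nonneg_left l3 hm
  linarith

/-- **LOCALITY OF THE NEUMANN FORM**: if `w` vanishes off `R ⊆ R₀` and at every site of `R` having a nearest
neighbour in `R₀ ∖ R`, then `QF_{R₀}(w) = QF_R(w)` (no bond of `R₀` leaving `R` is charged). [folklore] -/
theorem QF_local (hsub : R ⊆ R₀) (n : ℕ) (a m2 : ℝ) (w : (Fin (d + 1) → ℤ) → ℝ)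
    (hw0 : ∀ z, z ∉ R → w z = 0) (hw1 : ∀ x ∈ R, ∀ e ∈ R₀, e ∉ R → e ∈ nbrs x → w x = 0) :
    QF n a m2 R₀ w = QF n a m2 R w := by
  unfold QF
  have T0 : ∀ x y, (x ∉ R ∨ y ∉ R) → x ∈ R₀ → y ∈ R₀ →
      (if y ∈ nbrs x then (w x - w y) ^ 2 else 0) = 0 := by
    intro x y hxy hx hy
    split_ifs with hnb
    · rcases hxy with hx' | hy'
      · have wx := hw0 x hx'
        have wy : w y = 0 := by
          by_cases hyR : y ∈ R
          · exact hw1 y hyR x hx hx' (nbrs_comm.1 hnb)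
          · exact hw0 y hyR
        rw [wx, wy]
        ring
      · have wy := hw0 y hy'
        have wx : w x = 0 := by
          by_cases hxR : x ∈ R
          · exact hw1 x hxR y hy hy' hnb
          · exact hw0 x hxR
        rw [wx, wy]
        ring
    · rfl
  have l1 : (∑ x ∈ R₀, ∑ y ∈ R₀, if y ∈ nbrs x then (w x - w y) ^ 2 else 0)
      = ∑ x ∈ R, ∑ y ∈ R, if y ∈ nbrs x then (w x - w y) ^ 2 else 0 := by
    calc (∑ x ∈ R₀, ∑ y ∈ R₀, if y ∈ nbrs x then (w x - w y) ^ 2 else 0)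
        = ∑ x ∈ R₀, ∑ y ∈ R, (if y ∈ nbrs x then (w x - w y) ^ 2 else 0) :=
          Finset.sum_congr rfl fun x hx =>
            (Finset.sum_subset hsub fun y hy hyR => T0 x y (Or.inr hyR) hx hy).symm
      _ = _ := (Finset.sum_subset hsub fun x hx hxR =>
            Finset.sum_eq_zero fun y hy => T0 x y (Or.inl hxR) hx (hsub hy)).symm
  have l2 : ∑ b ∈ R₀.image (blk n), (∑ x ∈ R₀.filter (fun x => blk n x = b), w x) ^ 2
      = ∑ b ∈ R.image (blk n), (∑ x ∈ R.filter (fun x => blk n x = b), w x) ^ 2 := by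
    have hin : ∀ b, ∑ x ∈ R₀.filter (fun x => blk n x = b), w x = ∑ x ∈ R.filter (fun x => blk n x = b), w x := by
      intro b
      refine (Finset.sum_subset (Finset.filter_subset_filter _ hsub) fun x hx hxR => hw0 x ?_).symm
      exact fun h' => hxR (Finset.mem_filter.2 ⟨h', (Finset.mem_filter.1 hx).2⟩)
    calc _ = ∑ b ∈ R₀.image (blk n), (∑ x ∈ R.filter (fun x => blk n x = b), w x) ^ 2 :=
          Finset.sum_congr rfl fun b _ => by rw [hin b]
      _ = _ := by
          refine (Finset.sum_subset (Finset.image_subset_image hsub) fun b _ hbR => ?_).symm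
          have : ∑ x ∈ R.filter (fun x => blk n x = b), w x = 0 :=
            Finset.sum_eq_zero fun x hx => absurd
              (Finset.mem_image.2 ⟨x, (Finset.mem_filter.1 hx).1, (Finset.mem_filter.1 hx).2⟩) hbR
          rw [this]
          ring
  have l3 : ∑ x ∈ R₀, w x ^ 2 = ∑ x ∈ R, w x ^ 2 :=
    (Finset.sum_subset hsub fun x _ hxR => by rw [hw0 x hxR]; ring).symm
  rw [l1, l2, l3]

end Form

/-! ## §4  `G_k(Ω, 0) − G_k(Ω₀, 0)|_Ω ≥ 0` for nested block unions `Ω ⊆ Ω₀` (energy comparison) -/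

section Compare

variable {n : ℕ} {a m2 : ℝ} {Ω Ω₀ : Finset (Fin (d + 1) → ℤ)}

/-- nested sets of unit labels have nested fine regions. [folklore] -/
theorem fineDom_mono (hn : 1 ≤ n) (h : Ω ⊆ Ω₀) : fineDom n Ω ⊆ fineDom n Ω₀ := by
  intro x hx
  rw [mem_fineDom hn] at hx ⊢
  exact h hx

/-- `(−Δ + m² + aP)G = 1` on vectors. [folklore] -/
theorem green_mulVec (hn : 1 ≤ n) (ha : 0 < a) (hm : 0 ≤ m2) (Ω : Finset (Fin (d + 1) → ℤ))
    (g : ↥(fineDom n Ω) → ℝ) :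
    fineOpR n a m2 (fineDom n Ω) *ᵥ ((fineOpR n a m2 (fineDom n Ω))⁻¹ *ᵥ g) = g := by
  rw [Matrix.mulVec_mulVec, fineOpR_mul_inv_fineDom hn ha hm Ω, Matrix.one_mulVec]

/-- the form of `−Δ^{η,N}_Ω + m² + aP_k` is nonnegative (B4 (1.8) at `A = 0`). [folklore] -/
theorem fineOpR_psd (hn : 1 ≤ n) (ha : 0 < a) (hm : 0 ≤ m2) {R : Finset (Fin (d + 1) → ℤ)}
    (hR : IsBlockUnion n R) (w : ↥R → ℝ) : 0 ≤ w ⬝ᵥ fineOpR n a m2 R *ᵥ w := by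
  have h := lower18 hn ha.le m2 hR w
  have hpos : 0 < min 2 a + m2 := add_pos_of_pos_of_nonneg (lt_min two_pos ha) hm
  have hww : 0 ≤ w ⬝ᵥ w := Finset.sum_nonneg fun i _ => mul_self_nonneg (w i)
  nlinarith [hww]

/-- `0 ≤ ⟨g, G_k(Ω,0)g⟩`. [folklore] -/
theorem green_form_nonneg (hn : 1 ≤ n) (ha : 0 < a) (hm : 0 ≤ m2) (Ω : Finset (Fin (d + 1) → ℤ))
    (g : ↥(fineDom n Ω) → ℝ) : 0 ≤ g ⬝ᵥ (fineOpR n a m2 (fineDom n Ω))⁻¹ *ᵥ g := by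
  have h := fineOpR_psd hn ha hm (fineDom_isBlockUnion hn Ω) (m2 := m2) ((fineOpR n a m2 (fineDom n Ω))⁻¹ *ᵥ g)
  rwa [green_mulVec hn ha hm Ω g, dotProduct_comm] at h

/-- `⟨g, G_k(Ω,0)g⟩ ≤ ‖g‖²/min(2, a_k)` (B4 (1.8)/(1.9) at `A = 0` in form sense). [folklore] -/
theorem green_form_le (hn : 1 ≤ n) (ha : 0 < a) (hm : 0 ≤ m2) (Ω : Finset (Fin (d + 1) → ℤ))
    (g : ↥(fineDom n Ω) → ℝ) : g ⬝ᵥ (fineOpR n a m2 (fineDom n Ω))⁻¹ *ᵥ g ≤ (g ⬝ᵥ g) / min 2 a := by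
  refine inv_form_le (lt_min two_pos ha) (fun w => ?_) (green_mulVec hn ha hm Ω g)
  have h := lower18 hn ha.le m2 (fineDom_isBlockUnion hn Ω) w
  have hww : 0 ≤ w ⬝ᵥ w := Finset.sum_nonneg fun i _ => mul_self_nonneg (w i)
  nlinarith [hww]

/-- **`D(f, g) := ⟨f, G_k(Ω,0)g⟩ − ⟨f↑, G_k(Ω₀,0)g↑⟩`** — the form of the difference between the unit-lattice
Green's function of `Ω` and the compression to `Ω` of that of `Ω₀ ⊇ Ω` (`↑` = extension by zero).
[cite: Balaban1983RegularityDecay, p. 594 (5.5), dictionary] [folklore] -/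
def Dform (n : ℕ) (a m2 : ℝ) (Ω Ω₀ : Finset (Fin (d + 1) → ℤ)) (f g : ↥(fineDom n Ω) → ℝ) : ℝ :=
  f ⬝ᵥ (fineOpR n a m2 (fineDom n Ω))⁻¹ *ᵥ g
    - (fun z : ↥(fineDom n Ω₀) => extS (fineDom n Ω) f z.1)
        ⬝ᵥ (fineOpR n a m2 (fineDom n Ω₀))⁻¹ *ᵥ (fun z => extS (fineDom n Ω) g z.1)

/-- the difference matrix `M = G_k(Ω,0) − G_k(Ω₀,0)|_Ω` (compression along the inclusion of fine regions).
[folklore] -/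
def Mdiff (n : ℕ) (a m2 : ℝ) (Ω Ω₀ : Finset (Fin (d + 1) → ℤ)) (hRR : fineDom n Ω ⊆ fineDom n Ω₀) :
    Matrix ↥(fineDom n Ω) ↥(fineDom n Ω) ℝ :=
  (fineOpR n a m2 (fineDom n Ω))⁻¹
    - ((fineOpR n a m2 (fineDom n Ω₀))⁻¹).submatrix (incl hRR) (incl hRR)

/-- `D(f, g) = ⟨f, Mg⟩`. [folklore] -/
theorem Dform_eq_Mdiff (hRR : fineDom n Ω ⊆ fineDom n Ω₀) (f g : ↥(fineDom n Ω) → ℝ) :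
    Dform n a m2 Ω Ω₀ f g = f ⬝ᵥ Mdiff n a m2 Ω Ω₀ hRR *ᵥ g := by
  rw [Mdiff, Matrix.sub_mulVec, dotProduct_sub, dot_submatrix_incl]
  rfl

/-- `M` is symmetric. [folklore] -/
theorem Mdiff_isSymm (hRR : fineDom n Ω ⊆ fineDom n Ω₀) : (Mdiff n a m2 Ω Ω₀ hRR).IsSymm :=
  (fineOpR_inv_isSymm n a m2 _).sub ((fineOpR_inv_isSymm n a m2 _).submatrix _)

/-- `D` is symmetric. [folklore] -/
theorem Dform_comm (hn : 1 ≤ n) (h : Ω ⊆ Ω₀) (f g : ↥(fineDom n Ω) → ℝ) :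
    Dform n a m2 Ω Ω₀ f g = Dform n a m2 Ω Ω₀ g f := by
  rw [Dform_eq_Mdiff (fineDom_mono hn h), Dform_eq_Mdiff (fineDom_mono hn h),
    ← Matrix.dotProduct_transpose_mulVec _ f g, (Mdiff_isSymm _).eq]

/-- **`G_k(Ω, 0) ≥ G_k(Ω₀, 0)|_Ω` AS FORMS** for nested block unions `Ω ⊆ Ω₀`: `D(g, g) ≥ 0` for every `g`.
Mechanism (energy comparison, no regularity theory): with `U = G_k(Ω₀,0)g↑`,
`⟨g↑, U⟩ = 2⟨g↑, U⟩ − q_{Ω₀}(U) ≤ 2⟨g, U|_Ω⟩ − q_Ω(U|_Ω) ≤ ⟨g, G_k(Ω,0)g⟩`, the first inequality being the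
monotonicity of the Neumann form in the region (`QF_mono`), the second completing the square. [folklore] -/
theorem Dform_self_nonneg (hn : 1 ≤ n) (ha : 0 < a) (hm : 0 ≤ m2) (h : Ω ⊆ Ω₀)
    (g : ↥(fineDom n Ω) → ℝ) : 0 ≤ Dform n a m2 Ω Ω₀ g g := by
  have hRR : fineDom n Ω ⊆ fineDom n Ω₀ := fineDom_mono hn h
  unfold Dform
  set g₀ : ↥(fineDom n Ω₀) → ℝ := fun z => extS (fineDom n Ω) g z.1 with hg₀
  set U : ↥(fineDom n Ω₀) → ℝ := (fineOpR n a m2 (fineDom n Ω₀))⁻¹ *ᵥ g₀ with hU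
  have hAU : fineOpR n a m2 (fineDom n Ω₀) *ᵥ U = g₀ := green_mulVec hn ha hm Ω₀ g₀
  have hAw : fineOpR n a m2 (fineDom n Ω) *ᵥ ((fineOpR n a m2 (fineDom n Ω))⁻¹ *ᵥ g) = g :=
    green_mulVec hn ha hm Ω g
  have e1 : U ⬝ᵥ fineOpR n a m2 (fineDom n Ω₀) *ᵥ U = g₀ ⬝ᵥ U := by rw [hAU, dotProduct_comm]
  have e2 : (U ∘ incl hRR) ⬝ᵥ fineOpR n a m2 (fineDom n Ω) *ᵥ (U ∘ incl hRR)
      ≤ U ⬝ᵥ fineOpR n a m2 (fineDom n Ω₀) *ᵥ U := by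
    rw [form_eq_QF hn (fineDom_isBlockUnion hn Ω) a m2, form_eq_QF hn (fineDom_isBlockUnion hn Ω₀) a m2,
      QF_congr (fun z hz => extS_comp_incl hRR U hz)]
    exact QF_mono (fineDom_isBlockUnion hn Ω) hRR ha.le hm _
  have e3 : g₀ ⬝ᵥ U = g ⬝ᵥ (U ∘ incl hRR) := by
    simp only [hg₀, dotProduct]
    rw [sum_extS_mul hRR g U]
    rfl
  have e4 := two_dot_sub_form_le (fineOpR_isSymm n a m2 (fineDom n Ω))
    (fineOpR_psd hn ha hm (fineDom_isBlockUnion hn Ω)) hAw (U ∘ incl hRR)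
  linarith

/-- `M ≥ 0`. [folklore] -/
theorem Mdiff_psd (hn : 1 ≤ n) (ha : 0 < a) (hm : 0 ≤ m2) (h : Ω ⊆ Ω₀) (g : ↥(fineDom n Ω) → ℝ) :
    0 ≤ g ⬝ᵥ Mdiff n a m2 Ω Ω₀ (fineDom_mono hn h) *ᵥ g := by
  rw [← Dform_eq_Mdiff]
  exact Dform_self_nonneg hn ha hm h g

/-- **CAUCHY–SCHWARZ FOR THE DIFFERENCE**: `D(f, g)² ≤ D(f, f)·D(g, g)`. [folklore] -/
theorem Dform_sq_le (hn : 1 ≤ n) (ha : 0 < a) (hm : 0 ≤ m2) (h : Ω ⊆ Ω₀) (f g : ↥(fineDom n Ω) → ℝ) :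
    Dform n a m2 Ω Ω₀ f g ^ 2 ≤ Dform n a m2 Ω Ω₀ f f * Dform n a m2 Ω Ω₀ g g := by
  simp only [Dform_eq_Mdiff (fineDom_mono hn h)]
  exact dot_sq_le_of_psd (Mdiff_isSymm _) (Mdiff_psd hn ha hm h) f g

/-- the trivial bounds `0 ≤ D(g, g) ≤ ⟨g, G_k(Ω,0)g⟩ ≤ ‖g‖²/min(2, a_k)`. [folklore] -/
theorem Dform_self_le (hn : 1 ≤ n) (ha : 0 < a) (hm : 0 ≤ m2) (Ω₀ : Finset (Fin (d + 1) → ℤ))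
    (g : ↥(fineDom n Ω) → ℝ) : Dform n a m2 Ω Ω₀ g g ≤ (g ⬝ᵥ g) / min 2 a := by
  have h1 := green_form_le hn ha hm Ω g
  have h2 := green_form_nonneg hn ha hm Ω₀ (fun z : ↥(fineDom n Ω₀) => extS (fineDom n Ω) g z.1)
  unfold Dform
  linarith

end Compare

/-! ## §5  Block indicators: the entries of `Q_kG_k(Ω,0)Q_k^*` and of `Δ^{(k)}(Ω, 0)` as forms -/

section Blocks

variable {n : ℕ} {a m2 : ℝ} {Ω Ω₀ : Finset (Fin (d + 1) → ℤ)}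

/-- the indicator of the block `B(y)` on the fine region `η^{-1}Ω` (the row `y` of `indR`). [folklore] -/
def blockInd (n : ℕ) (Ω : Finset (Fin (d + 1) → ℤ)) (y : ↥Ω) : ↥(fineDom n Ω) → ℝ := fun x => indR n Ω y x

/-- the block indicator at a fine point: `1` iff the point's unit block is `y`. [folklore] -/
theorem blockInd_apply (y : ↥Ω) (x : ↥(fineDom n Ω)) :
    blockInd n Ω y x = if blk n x.1 = y.1 then 1 else 0 := rfl

/-- the zero extension to `η^{-1}Ω₀` of the indicator of a block of `Ω ⊆ Ω₀` is the indicator of that block.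
[folklore] -/
theorem blockInd_ext (hn : 1 ≤ n) (h : Ω ⊆ Ω₀) (y : ↥Ω) (z : ↥(fineDom n Ω₀)) :
    extS (fineDom n Ω) (blockInd n Ω y) z.1 = blockInd n Ω₀ (incl h y) z := by
  rw [blockInd_apply]
  by_cases hz : z.1 ∈ fineDom n Ω
  · rw [extS_of_mem _ hz, blockInd_apply]
    rfl
  · have hne : blk n z.1 ≠ y.1 := fun he => hz (by rw [mem_fineDom hn, he]; exact y.2)
    simp [extS, hz, hne]

/-- the zero extension of a block indicator, as a function on `η^{-1}Ω₀`. [folklore] -/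
theorem blockInd_ext_fun (hn : 1 ≤ n) (h : Ω ⊆ Ω₀) (y : ↥Ω) :
    (fun z : ↥(fineDom n Ω₀) => extS (fineDom n Ω) (blockInd n Ω y) z.1) = blockInd n Ω₀ (incl h y) :=
  funext fun z => blockInd_ext hn h y z

/-- `(Q_kGQ_k^*)(y, y′) = ⟨1_{B(y)}, G1_{B(y′)}⟩`. [folklore] -/
theorem pairing_entry (G : Matrix ↥(fineDom n Ω) ↥(fineDom n Ω) ℝ) (y y' : ↥Ω) :
    (indR n Ω * G * (indR n Ω)ᵀ) y y' = blockInd n Ω y ⬝ᵥ G *ᵥ blockInd n Ω y' := by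
  simp only [Matrix.mul_apply, Matrix.transpose_apply, dotProduct, Matrix.mulVec, blockInd, Finset.sum_mul]
  rw [Finset.sum_comm]
  refine Finset.sum_congr rfl fun x _ => ?_
  rw [Finset.mul_sum]
  exact Finset.sum_congr rfl fun x' _ => by ring

/-- `‖1_{B(y)}‖² = n^{d+1}`. [folklore] -/
theorem blockInd_sq (hn : 1 ≤ n) (y : ↥Ω) : blockInd n Ω y ⬝ᵥ blockInd n Ω y = (n : ℝ) ^ (d + 1) := by
  have h1 : ∀ x : ↥(fineDom n Ω), blockInd n Ω y x * blockInd n Ω y x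
      = if blk n x.1 = y.1 then (1 : ℝ) else 0 := by
    intro x
    rw [blockInd_apply]
    split_ifs <;> simp
  simp only [dotProduct, h1]
  rw [Finset.sum_boole]
  have := card_filter_blkR hn Ω y
  rw [this]
  push_cast
  rfl

/-- **`D` ON BLOCK INDICATORS IS THE DIFFERENCE OF THE BLOCK PAIRINGS**:
`D(1_{B(y)}, 1_{B(y′)}) = (Q_kG_k(Ω,0)Q_k^*)(y,y′) − (Q_kG_k(Ω₀,0)Q_k^*)(y,y′)`. [folklore] -/
theorem Dform_blockInd (hn : 1 ≤ n) (h : Ω ⊆ Ω₀) (y y' : ↥Ω) :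
    Dform n a m2 Ω Ω₀ (blockInd n Ω y) (blockInd n Ω y')
      = (indR n Ω * (fineOpR n a m2 (fineDom n Ω))⁻¹ * (indR n Ω)ᵀ) y y'
        - (indR n Ω₀ * (fineOpR n a m2 (fineDom n Ω₀))⁻¹ * (indR n Ω₀)ᵀ) (incl h y) (incl h y') := by
  rw [Dform, blockInd_ext_fun hn h y, blockInd_ext_fun hn h y', pairing_entry, pairing_entry]

/-- **`Δ^{(k)}(Ω, 0) − Δ^{(k)}(Ω₀, 0)|_Ω = −(a_k²/n^{d+1})·D` ON BLOCK INDICATORS** (B4 (1.14) at `A = 0`: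
`Δ^{(k)} = a_kI − a_k²Q_kG_kQ_k^*`). [cite: Balaban1983RegularityDecay, p. 573 (1.14), dictionary] [folklore] -/
theorem KeffR_sub_eq (hn : 1 ≤ n) (h : Ω ⊆ Ω₀) (y y' : ↥Ω) :
    KeffR n a m2 Ω y y' - KeffR n a m2 Ω₀ (incl h y) (incl h y')
      = -(a ^ 2 * ((n : ℝ) ^ (d + 1))⁻¹) * Dform n a m2 Ω Ω₀ (blockInd n Ω y) (blockInd n Ω y') := by
  rw [Dform_blockInd hn h]
  simp only [KeffR, Matrix.sub_apply, Matrix.smul_apply, Matrix.one_apply, incl_eq_iff, smul_eq_mul]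
  ring

end Blocks

/-! ## §6  The sup-distance to a finite set and the boundary cutoff `θ` -/

section Cutoff

/-- the sup-distance from a site to a finite set of sites (`= 0` for the empty set). [folklore] -/
def dSet (E : Finset (Fin (d + 1) → ℤ)) (x : Fin (d + 1) → ℤ) : ℝ :=
  sInf ((fun e => supNorm (x - e)) '' (E : Set (Fin (d + 1) → ℤ)))

/-- the distance to a set is nonnegative. [folklore] -/
theorem dSet_nonneg (E : Finset (Fin (d + 1) → ℤ)) (x : Fin (d + 1) → ℤ) : 0 ≤ dSet E x := by
  apply Real.sInf_nonneg
  rintro _ ⟨e, _, rfl⟩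
  exact supNorm_nonneg _

/-- the distance to a set is at most the distance to any of its members. [folklore] -/
theorem dSet_le {E : Finset (Fin (d + 1) → ℤ)} (x : Fin (d + 1) → ℤ) {e : Fin (d + 1) → ℤ} (he : e ∈ E) :
    dSet E x ≤ supNorm (x - e) := by
  apply csInf_le
  · refine ⟨0, ?_⟩
    rintro _ ⟨e', _, rfl⟩
    exact supNorm_nonneg _
  · exact ⟨e, Finset.mem_coe.2 he, rfl⟩

/-- the distance to the empty set is the junk value `sInf ∅ = 0`. [folklore] -/
theorem dSet_empty (x : Fin (d + 1) → ℤ) : dSet (∅ : Finset (Fin (d + 1) → ℤ)) x = 0 := by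
  simp [dSet]

/-- the distance to a nonempty finite set is attained. [folklore] -/
theorem dSet_attained {E : Finset (Fin (d + 1) → ℤ)} (hE : E.Nonempty) (x : Fin (d + 1) → ℤ) :
    ∃ e ∈ E, dSet E x = supNorm (x - e) := by
  have hne : ((fun e => supNorm (x - e)) '' (E : Set (Fin (d + 1) → ℤ))).Nonempty :=
    ⟨_, ⟨hE.choose, Finset.mem_coe.2 hE.choose_spec, rfl⟩⟩
  have hfin : ((fun e => supNorm (x - e)) '' (E : Set (Fin (d + 1) → ℤ))).Finite :=
    (Finset.finite_toSet E).image _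
  obtain ⟨e, he, h⟩ := (Set.mem_image _ _ _).1 (hne.csInf_mem hfin)
  exact ⟨e, Finset.mem_coe.1 he, h.symm⟩

/-- the sup norm of a difference is symmetric. [folklore] -/
theorem supNorm_sub_comm (x y : Fin (d + 1) → ℤ) : supNorm (x - y) = supNorm (y - x) := by
  rw [← B4TorusKernel.supNorm_neg, neg_sub]

/-- `dist(·, E)` is `1`-Lipschitz for the sup norm. [folklore] -/
theorem dSet_lip (E : Finset (Fin (d + 1) → ℤ)) (x x' : Fin (d + 1) → ℤ) :
    dSet E x ≤ supNorm (x - x') + dSet E x' := by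
  rcases Finset.eq_empty_or_nonempty E with rfl | hE
  · rw [dSet_empty, dSet_empty, add_zero]
    exact supNorm_nonneg _
  · obtain ⟨e, he, h⟩ := dSet_attained hE x'
    have h1 := dSet_le x he
    have h2 := supNorm_add_le (x - x') (x' - e)
    rw [sub_add_sub_cancel] at h2
    linarith

/-- `|dist(x, E) − dist(x′, E)| ≤ |x − x′|_∞`. [folklore] -/
theorem abs_dSet_sub_le (E : Finset (Fin (d + 1) → ℤ)) (x x' : Fin (d + 1) → ℤ) :
    |dSet E x - dSet E x'| ≤ supNorm (x - x') := by
  rw [abs_le]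
  have h1 := dSet_lip E x x'
  have h2 := dSet_lip E x' x
  rw [supNorm_sub_comm x' x] at h2
  constructor <;> linarith

/-- an integer vector of sup norm `< k + 1` has sup norm `≤ k`. [folklore] -/
theorem supNorm_le_of_lt {v : Fin (d + 1) → ℤ} {k : ℤ} (h : supNorm v < (k : ℝ) + 1) : supNorm v ≤ k := by
  obtain ⟨i, hi⟩ := exists_supNorm_eq v
  rw [hi] at h ⊢
  have : |v i| < k + 1 := by exact_mod_cast h
  exact_mod_cast (Int.lt_add_one_iff.1 this)

/-- **THE BOUNDARY CUTOFF** `θ(x) = min(1, max(0, 1 − (dist(x, E) − 1)/n))`: equal to `1` at the sites adjacent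
to `E`, decreasing to `0` at sup-distance `n + 1` from `E`, with slope `1/n = η` (an `η`-scale smooth cutoff in
lattice units). [folklore] -/
def cutoff (n : ℕ) (E : Finset (Fin (d + 1) → ℤ)) (x : Fin (d + 1) → ℤ) : ℝ :=
  min 1 (max 0 (1 - (dSet E x - 1) / n))

/-- `θ ≥ 0`. [folklore] -/
theorem cutoff_nonneg (n : ℕ) (E : Finset (Fin (d + 1) → ℤ)) (x : Fin (d + 1) → ℤ) : 0 ≤ cutoff n E x :=
  le_min zero_le_one (le_max_left _ _)

/-- `θ ≤ 1`. [folklore] -/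
theorem cutoff_le_one (n : ℕ) (E : Finset (Fin (d + 1) → ℤ)) (x : Fin (d + 1) → ℤ) : cutoff n E x ≤ 1 :=
  min_le_left _ _

/-- `|θ(x) − θ(x′)| ≤ 1` (both values in `[0, 1]`). [folklore] -/
theorem abs_cutoff_sub_le_one (n : ℕ) (E : Finset (Fin (d + 1) → ℤ)) (x x' : Fin (d + 1) → ℤ) :
    |cutoff n E x - cutoff n E x'| ≤ 1 := by
  rw [abs_le]
  have := cutoff_nonneg n E x
  have := cutoff_le_one n E x
  have := cutoff_nonneg n E x'
  have := cutoff_le_one n E x'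
  constructor <;> linarith

/-- `θ = 1` at every site with a nearest neighbour in `E`. [folklore] -/
theorem cutoff_eq_one_of_nbr {n : ℕ} (hn : 1 ≤ n) {E : Finset (Fin (d + 1) → ℤ)} {x e : Fin (d + 1) → ℤ}
    (he : e ∈ E) (hxe : e ∈ nbrs x) : cutoff n E x = 1 := by
  have hn0 : (0 : ℝ) < n := by exact_mod_cast hn
  have h1 : dSet E x ≤ 1 := (dSet_le x he).trans (supNorm_sub_le_one_of_mem_nbrs hxe)
  have h2 : (dSet E x - 1) / n ≤ 0 := div_nonpos_of_nonpos_of_nonneg (by linarith) hn0.le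
  unfold cutoff
  rw [min_eq_left_iff]
  exact le_max_of_le_right (by linarith)

/-- **`θ` IS `η`-LIPSCHITZ**: `|θ(x) − θ(x′)| ≤ |x − x′|_∞/n`. [folklore] -/
theorem abs_cutoff_sub_le {n : ℕ} (hn : 1 ≤ n) (E : Finset (Fin (d + 1) → ℤ)) (x x' : Fin (d + 1) → ℤ) :
    |cutoff n E x - cutoff n E x'| ≤ supNorm (x - x') / n := by
  have hn0 : (0 : ℝ) < n := by exact_mod_cast hn
  unfold cutoff
  have h1 := abs_min_sub_min_le_max (1 : ℝ) (max 0 (1 - (dSet E x - 1) / n)) 1 (max 0 (1 - (dSet E x' - 1) / n))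
  have h2 := abs_max_sub_max_le_max (0 : ℝ) (1 - (dSet E x - 1) / n) 0 (1 - (dSet E x' - 1) / n)
  rw [sub_self, abs_zero] at h1 h2
  have h3 : |(1 - (dSet E x - 1) / n) - (1 - (dSet E x' - 1) / n)| = |dSet E x - dSet E x'| / n := by
    rw [show (1 - (dSet E x - 1) / n) - (1 - (dSet E x' - 1) / n) = -((dSet E x - dSet E x') / n) by ring,
      abs_neg, abs_div, abs_of_pos hn0]
  have h4 := abs_dSet_sub_le E x x'
  have h5 : |dSet E x - dSet E x'| / n ≤ supNorm (x - x') / n := div_le_div_of_nonneg_right h4 hn0.le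
  have hm0 : ∀ t : ℝ, max 0 t = t ↔ 0 ≤ t := fun t => max_eq_right_iff
  calc |min 1 (max 0 (1 - (dSet E x - 1) / ↑n)) - min 1 (max 0 (1 - (dSet E x' - 1) / ↑n))|
      ≤ max 0 |max 0 (1 - (dSet E x - 1) / ↑n) - max 0 (1 - (dSet E x' - 1) / ↑n)| := h1
    _ = |max 0 (1 - (dSet E x - 1) / ↑n) - max 0 (1 - (dSet E x' - 1) / ↑n)| :=
        max_eq_right (abs_nonneg _)
    _ ≤ max 0 |(1 - (dSet E x - 1) / n) - (1 - (dSet E x' - 1) / n)| := h2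
    _ = |(1 - (dSet E x - 1) / n) - (1 - (dSet E x' - 1) / n)| := max_eq_right (abs_nonneg _)
    _ ≤ supNorm (x - x') / n := by rw [h3]; exact h5

/-- **SUPPORT OF `θ`**: `θ(x) ≠ 0` forces a site of `E` within sup-distance `< n + 1` of `x`, hence a block of
`E` within block-sup-distance `1` of the block of `x`. [folklore] -/
theorem exists_near_of_cutoff_ne_zero {n : ℕ} (hn : 1 ≤ n) {E : Finset (Fin (d + 1) → ℤ)} (hE : E.Nonempty)
    {x : Fin (d + 1) → ℤ} (h : cutoff n E x ≠ 0) : ∃ e ∈ E, supNorm (blk n x - blk n e) ≤ 1 := by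
  have hn0 : (0 : ℝ) < n := by exact_mod_cast hn
  obtain ⟨e, he, hde⟩ := dSet_attained hE x
  refine ⟨e, he, ?_⟩
  have h1 : dSet E x < n + 1 := by
    by_contra hcon
    push Not at hcon
    have h2 : 1 ≤ (dSet E x - 1) / n := by
      rw [le_div_iff₀ hn0]
      linarith
    have h3 : max 0 (1 - (dSet E x - 1) / n) = 0 := max_eq_left (by linarith)
    apply h
    unfold cutoff
    rw [h3, min_eq_right zero_le_one]
  have h4 := supNorm_blk_sub_blk_le hn x e
  have h5 : (supNorm (x - e) + ((n : ℝ) - 1)) / n < 2 := by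
    rw [div_lt_iff₀ hn0, ← hde]
    linarith
  have h6 : supNorm (blk n x - blk n e) < ((1 : ℤ) : ℝ) + 1 := by
    push_cast
    linarith
  exact_mod_cast supNorm_le_of_lt h6

end Cutoff

/-! ## §7  The diagonal estimate by IMS localisation:
`D(1_{B(y)}, 1_{B(y)}) ≤ ((d+1) + a_k/2)·Σ_{x ∈ layer} (G_k(Ω,0)1_{B(y)})(x)²` for `dist(y, Ω₀ ∖ Ω) ≥ 2` -/

section Diagonal

variable {n : ℕ} {a m2 : ℝ} {Ω Ω₀ : Finset (Fin (d + 1) → ℤ)}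

/-- the outer fine points `η^{-1}Ω₀ ∖ η^{-1}Ω`. [folklore] -/
def outerFine (n : ℕ) (Ω Ω₀ : Finset (Fin (d + 1) → ℤ)) : Finset (Fin (d + 1) → ℤ) :=
  fineDom n Ω₀ \ fineDom n Ω

/-- membership in the outer fine points: the unit block lies in `Ω₀` but not in `Ω`. [folklore] -/
theorem mem_outerFine (hn : 1 ≤ n) {e : Fin (d + 1) → ℤ} :
    e ∈ outerFine n Ω Ω₀ ↔ blk n e ∈ Ω₀ ∧ blk n e ∉ Ω := by
  rw [outerFine, Finset.mem_sdiff, mem_fineDom hn, mem_fineDom hn]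

/-- a lower bound on a distance to a set forces the set to be nonempty. [folklore] -/
theorem nonempty_of_le_dSet {S : Finset (Fin (d + 1) → ℤ)} {x : Fin (d + 1) → ℤ} {c : ℝ} (hc : 0 < c)
    (h : c ≤ dSet S x) : S.Nonempty := by
  by_contra hS
  rw [Finset.not_nonempty_iff_eq_empty] at hS
  rw [hS, dSet_empty] at h
  linarith

/-- if `Ω₀ ∖ Ω` has a site, the outer fine region has a point (the corner of that site's block). [folklore] -/
theorem outerFine_nonempty (hn : 1 ≤ n) (hS : (Ω₀ \ Ω).Nonempty) : (outerFine n Ω Ω₀).Nonempty := by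
  obtain ⟨v, hv⟩ := hS
  rw [Finset.mem_sdiff] at hv
  refine ⟨finePt n v (fun _ => ⟨0, by omega⟩), ?_⟩
  rw [mem_outerFine hn, blk_finePt hn]
  exact hv

/-- **THE BOUNDARY LAYER**: the fine points of `η^{-1}Ω` whose unit block lies within sup-distance `2` of
`Ω₀ ∖ Ω`. [folklore] -/
def layer2 (n : ℕ) (Ω Ω₀ : Finset (Fin (d + 1) → ℤ)) : Finset ↥(fineDom n Ω) :=
  open Classical in Finset.univ.filter (fun x => ∃ v ∈ Ω₀ \ Ω, supNorm (blk n x.1 - v) ≤ 2)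

/-- membership in the boundary layer. [folklore] -/
theorem mem_layer2 {x : ↥(fineDom n Ω)} :
    x ∈ layer2 n Ω Ω₀ ↔ ∃ v ∈ Ω₀ \ Ω, supNorm (blk n x.1 - v) ≤ 2 := by
  classical
  simp only [layer2, Finset.mem_filter, Finset.mem_univ, true_and]

/-- where the cutoff varies between two fine points whose blocks are within sup-distance `1`, the first point is
in the boundary layer. [folklore] -/
theorem layer2_of_cutoff_ne (hn : 1 ≤ n) {x x' : ↥(fineDom n Ω)}
    (hθ : cutoff n (outerFine n Ω Ω₀) x.1 ≠ cutoff n (outerFine n Ω Ω₀) x'.1)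
    (hb : supNorm (blk n x.1 - blk n x'.1) ≤ 1) : x ∈ layer2 n Ω Ω₀ := by
  rw [mem_layer2]
  have hE : (outerFine n Ω Ω₀).Nonempty := by
    by_contra hcon
    rw [Finset.not_nonempty_iff_eq_empty] at hcon
    apply hθ
    simp only [cutoff, hcon, dSet_empty]
  by_cases h0 : cutoff n (outerFine n Ω Ω₀) x.1 = 0
  · have h0' : cutoff n (outerFine n Ω Ω₀) x'.1 ≠ 0 := by
      rw [h0] at hθ
      exact Ne.symm hθ
    obtain ⟨e, he, h1⟩ := exists_near_of_cutoff_ne_zero hn hE h0'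
    rw [mem_outerFine hn] at he
    refine ⟨blk n e, Finset.mem_sdiff.2 he, ?_⟩
    have h2 := supNorm_add_le (blk n x.1 - blk n x'.1) (blk n x'.1 - blk n e)
    rw [sub_add_sub_cancel] at h2
    linarith
  · obtain ⟨e, he, h1⟩ := exists_near_of_cutoff_ne_zero hn hE h0
    rw [mem_outerFine hn] at he
    exact ⟨blk n e, Finset.mem_sdiff.2 he, h1.trans (by norm_num)⟩

/-- the off-diagonal entries of `−Δ^{η,N}_Ω + m² + a_kP_k`: `|A(x, x′)| ≤ n²·1_{x′ ∼ x} + (a/n^{d+1})·1_{same block}`.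
[folklore] -/
theorem abs_fineOpR_apply_le (n : ℕ) {a : ℝ} (m2 : ℝ) (ha : 0 ≤ a) {R : Finset (Fin (d + 1) → ℤ)}
    {x x' : ↥R} (hne : x' ≠ x) :
    |fineOpR n a m2 R x x'| ≤ (n : ℝ) ^ 2 * (if x'.1 ∈ nbrs x.1 then 1 else 0)
        + (if blk n x'.1 = blk n x.1 then a * ((n : ℝ) ^ (d + 1))⁻¹ else 0) := by
  have h1 : x'.1 ≠ x.1 := fun h => hne (Subtype.ext h)
  have e : fineOpR n a m2 R x x' = (n : ℝ) ^ 2 * (if x'.1 ∈ nbrs x.1 then -1 else 0)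
      + (if blk n x'.1 = blk n x.1 then a * ((n : ℝ) ^ (d + 1))⁻¹ else 0) := by
    simp only [fineOpR, regionOpR, Matrix.of_apply, neumannLapR, diagK, avgK, h1, if_false, zero_add]
  rw [e]
  have ha' : 0 ≤ a * ((n : ℝ) ^ (d + 1))⁻¹ := by positivity
  have hn2 : 0 ≤ (n : ℝ) ^ 2 := by positivity
  split_ifs <;> (rw [abs_le]; constructor <;> linarith)

/-- the IMS error, term by term: `|A(x,x′)|(θ(x) − θ(x′))²` vanishes unless `x` is in the boundary layer, and is
then at most `1_{x′ ∼ x} + (a/n^{d+1})1_{same block}` (`θ` is `η`-Lipschitz and `[0,1]`-valued). [folklore] -/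
theorem ims_term_le (hn : 1 ≤ n) (ha : 0 ≤ a) (x x' : ↥(fineDom n Ω)) :
    |fineOpR n a m2 (fineDom n Ω) x x'|
        * (cutoff n (outerFine n Ω Ω₀) x.1 - cutoff n (outerFine n Ω Ω₀) x'.1) ^ 2
      ≤ if x ∈ layer2 n Ω Ω₀ then
          (if x'.1 ∈ nbrs x.1 then (1 : ℝ) else 0)
            + (if blk n x'.1 = blk n x.1 then a * ((n : ℝ) ^ (d + 1))⁻¹ else 0)
        else 0 := by
  have hn0 : (0 : ℝ) < n := by exact_mod_cast hn
  have ha' : 0 ≤ a * ((n : ℝ) ^ (d + 1))⁻¹ := by positivity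
  set t := cutoff n (outerFine n Ω Ω₀) x.1 - cutoff n (outerFine n Ω Ω₀) x'.1 with ht
  by_cases hd : cutoff n (outerFine n Ω Ω₀) x.1 = cutoff n (outerFine n Ω Ω₀) x'.1
  · have : t = 0 := by rw [ht, hd, sub_self]
    rw [this, zero_pow two_ne_zero, mul_zero]
    split_ifs <;> positivity
  · have hne : x' ≠ x := fun h => hd (by rw [h])
    have hsq1 : t ^ 2 ≤ 1 := by
      have h1 := abs_cutoff_sub_le_one n (outerFine n Ω Ω₀) x.1 x'.1
      rw [← ht] at h1
      have h2 : |t| ^ 2 ≤ 1 ^ 2 := pow_le_pow_left₀ (abs_nonneg _) h1 2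
      rw [sq_abs, one_pow] at h2
      exact h2
    have hA := abs_fineOpR_apply_le n m2 ha hne
    have habs := abs_nonneg (fineOpR n a m2 (fineDom n Ω) x x')
    by_cases hnb : x'.1 ∈ nbrs x.1
    · have hs1 : supNorm (x.1 - x'.1) ≤ 1 := supNorm_sub_le_one_of_mem_nbrs hnb
      have hsqn : (n : ℝ) ^ 2 * t ^ 2 ≤ 1 := by
        have h1 := abs_cutoff_sub_le hn (outerFine n Ω Ω₀) x.1 x'.1
        rw [← ht] at h1
        have h2 : |t| ≤ 1 / n := h1.trans (div_le_div_of_nonneg_right hs1 hn0.le)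
        have h3 : |t| * n ≤ 1 := by rwa [le_div_iff₀ hn0] at h2
        have h4 : (|t| * n) ^ 2 ≤ 1 ^ 2 := pow_le_pow_left₀ (by positivity) h3 2
        rw [mul_pow, sq_abs, one_pow] at h4
        linarith
      have hbl : supNorm (blk n x.1 - blk n x'.1) ≤ 1 := by
        have h1 := supNorm_blk_sub_blk_le hn x.1 x'.1
        have h2 : (supNorm (x.1 - x'.1) + ((n : ℝ) - 1)) / n ≤ 1 := by
          rw [div_le_iff₀ hn0]
          linarith
        linarith
      have hL : x ∈ layer2 n Ω Ω₀ := layer2_of_cutoff_ne hn hd hbl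
      rw [if_pos hL, if_pos hnb]
      rw [if_pos hnb, mul_one] at hA
      have hm := mul_le_mul_of_nonneg_right hA (sq_nonneg t)
      split_ifs with hb2
      · rw [if_pos hb2] at hm
        nlinarith
      · rw [if_neg hb2] at hm
        nlinarith
    · rw [if_neg hnb, mul_zero, zero_add] at hA
      by_cases hb2 : blk n x'.1 = blk n x.1
      · have hbl : supNorm (blk n x.1 - blk n x'.1) ≤ 1 := by
          rw [hb2, sub_self, supNorm_zero']
          norm_num
        have hL : x ∈ layer2 n Ω Ω₀ := layer2_of_cutoff_ne hn hd hbl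
        rw [if_pos hL, if_neg hnb, if_pos hb2, zero_add]
        rw [if_pos hb2] at hA
        have hm := mul_le_mul_of_nonneg_right hA (sq_nonneg t)
        nlinarith
      · rw [if_neg hb2] at hA
        have h0 : |fineOpR n a m2 (fineDom n Ω) x x'| = 0 := le_antisymm hA habs
        rw [h0, zero_mul]
        split_ifs <;> positivity

/-- the IMS error, row by row: `Σ_{x′}|A(x,x′)|(θ(x) − θ(x′))² ≤ (2(d+1) + a)·1_{layer}(x)`. [folklore] -/
theorem ims_row_le (hn : 1 ≤ n) (ha : 0 ≤ a) (x : ↥(fineDom n Ω)) :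
    ∑ x', |fineOpR n a m2 (fineDom n Ω) x x'|
        * (cutoff n (outerFine n Ω Ω₀) x.1 - cutoff n (outerFine n Ω Ω₀) x'.1) ^ 2
      ≤ if x ∈ layer2 n Ω Ω₀ then 2 * ((d : ℝ) + 1) + a else 0 := by
  have hn0 : (0 : ℝ) < n := by exact_mod_cast hn
  refine (Finset.sum_le_sum fun x' _ => ims_term_le (m2 := m2) (Ω₀ := Ω₀) hn ha x x').trans ?_
  split_ifs with hL
  · rw [Finset.sum_add_distrib, Finset.sum_boole]
    have h1 : ((Finset.univ.filter (fun x' : ↥(fineDom n Ω) => x'.1 ∈ nbrs x.1)).card : ℝ)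
        ≤ 2 * ((d : ℝ) + 1) := by
      have hc : (Finset.univ.filter (fun x' : ↥(fineDom n Ω) => x'.1 ∈ nbrs x.1)).card ≤ (nbrs x.1).card :=
        Finset.card_le_card_of_injOn (fun x' => x'.1) (fun x' hx' => (Finset.mem_filter.1 hx').2)
          (fun _ _ _ _ h => Subtype.ext h)
      rw [card_nbrs] at hc
      have : ((Finset.univ.filter (fun x' : ↥(fineDom n Ω) => x'.1 ∈ nbrs x.1)).card : ℝ)
          ≤ ((2 * (d + 1) : ℕ) : ℝ) := by exact_mod_cast hc
      push_cast at this
      exact this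
    have hxΩ : blk n x.1 ∈ Ω := (mem_fineDom hn).1 x.2
    have h2 : ∑ x' : ↥(fineDom n Ω), (if blk n x'.1 = blk n x.1 then a * ((n : ℝ) ^ (d + 1))⁻¹ else 0) = a := by
      rw [← Finset.sum_filter, Finset.sum_const, nsmul_eq_mul]
      have hc := card_filter_blkR hn Ω ⟨blk n x.1, hxΩ⟩
      simp only at hc
      rw [hc]
      push_cast
      field_simp
    rw [h2]
    linarith
  · simp

/-- **THE DIAGONAL ESTIMATE.**  For nested block unions `Ω ⊆ Ω₀`, a unit site `y ∈ Ω` with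
`dist_∞(y, Ω₀ ∖ Ω) ≥ 2` and `u = G_k(Ω,0)1_{B(y)}`:
`0 ≤ D(1_{B(y)}, 1_{B(y)}) ≤ ((d+1) + a_k/2)·Σ_{x ∈ layer} u(x)²`.
Mechanism: test the variational characterisation of `⟨1_B, G_k(Ω₀,0)1_B⟩` with the zero extension of `(1 − θ)u`
(`θ` the boundary cutoff, `≡ 1` next to `η^{-1}(Ω₀ ∖ Ω)` so that no boundary bond is charged — `QF_local`),
expand `q_Ω((1 − θ)u) = ⟨1_B, u⟩ + q_Ω(θu)` (`θ·1_B = 0`), and evaluate `q_Ω(θu)` by the IMS identity: only the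
commutator `Σ|A(x,x′)|(θ(x) − θ(x′))²u(x)²` over the boundary layer survives, with `|∇θ| ≤ η` against the
coupling `η^{-2}`. [folklore] -/
theorem Dform_diag_le_layer (hn : 1 ≤ n) (ha : 0 < a) (hm : 0 ≤ m2) (h : Ω ⊆ Ω₀) (y : ↥Ω)
    (hy : 2 ≤ dSet (Ω₀ \ Ω) y.1) :
    Dform n a m2 Ω Ω₀ (blockInd n Ω y) (blockInd n Ω y)
      ≤ (((d : ℝ) + 1) + a / 2)
          * ∑ x ∈ layer2 n Ω Ω₀, ((fineOpR n a m2 (fineDom n Ω))⁻¹ *ᵥ blockInd n Ω y) x ^ 2 := by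
  have hRR : fineDom n Ω ⊆ fineDom n Ω₀ := fineDom_mono hn h
  have hBU := fineDom_isBlockUnion hn Ω
  have hBU₀ := fineDom_isBlockUnion hn Ω₀
  have hE : (outerFine n Ω Ω₀).Nonempty := outerFine_nonempty hn (nonempty_of_le_dSet two_pos hy)
  unfold Dform
  set f := blockInd n Ω y with hf
  set u := (fineOpR n a m2 (fineDom n Ω))⁻¹ *ᵥ f with hu
  set θ : ↥(fineDom n Ω) → ℝ := fun x => cutoff n (outerFine n Ω Ω₀) x.1 with hθ
  set f₀ : ↥(fineDom n Ω₀) → ℝ := fun z => extS (fineDom n Ω) f z.1 with hf₀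
  have hAu : fineOpR n a m2 (fineDom n Ω) *ᵥ u = f := green_mulVec hn ha hm Ω f
  -- the cutoff kills the block indicator
  have hθf : ∀ x, θ x * f x = 0 := by
    intro x
    by_cases hbx : blk n x.1 = y.1
    · suffices hθ0 : θ x = 0 by rw [hθ0, zero_mul]
      by_contra hθx
      obtain ⟨e, he, h1⟩ := exists_near_of_cutoff_ne_zero hn hE hθx
      rw [mem_outerFine hn] at he
      have h2 := dSet_le y.1 (Finset.mem_sdiff.2 he)
      rw [hbx] at h1
      linarith
    · have : f x = 0 := by rw [hf, blockInd_apply, if_neg hbx]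
      rw [this, mul_zero]
  -- the trial vector and its zero extension
  set v : ↥(fineDom n Ω) → ℝ := u - fun x => θ x * u x with hv
  set W : ↥(fineDom n Ω₀) → ℝ := fun z => extS (fineDom n Ω) v z.1 with hW
  have hA₀w : fineOpR n a m2 (fineDom n Ω₀) *ᵥ ((fineOpR n a m2 (fineDom n Ω₀))⁻¹ *ᵥ f₀) = f₀ :=
    green_mulVec hn ha hm Ω₀ f₀
  have i1 := two_dot_sub_form_le (fineOpR_isSymm n a m2 (fineDom n Ω₀)) (fineOpR_psd hn ha hm hBU₀) hA₀w W
  have i2 : f₀ ⬝ᵥ W = f ⬝ᵥ u := by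
    simp only [hf₀, hW, dotProduct]
    rw [sum_extS_mul hRR f (fun z => extS (fineDom n Ω) v z.1)]
    refine Finset.sum_congr rfl fun x _ => ?_
    simp only [incl_val, extS_coe, hv, Pi.sub_apply]
    have := hθf x
    rw [mul_sub, show f x * (θ x * u x) = (θ x * f x) * u x by ring, this, zero_mul, sub_zero]
  have i3 : W ⬝ᵥ fineOpR n a m2 (fineDom n Ω₀) *ᵥ W = v ⬝ᵥ fineOpR n a m2 (fineDom n Ω) *ᵥ v := by
    rw [form_eq_QF hn hBU₀, form_eq_QF hn hBU, hW, extS_extS hRR v]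
    refine QF_local hRR n a m2 (extS (fineDom n Ω) v) (fun z hz => by simp [extS, hz]) ?_
    intro x hx e he heR henb
    rw [extS_of_mem _ hx]
    have hθ1 : θ ⟨x, hx⟩ = 1 :=
      cutoff_eq_one_of_nbr hn (E := outerFine n Ω Ω₀) (Finset.mem_sdiff.2 ⟨he, heR⟩) henb
    simp only [hv, Pi.sub_apply, hθ1, one_mul, sub_self]
  have i4 : v ⬝ᵥ fineOpR n a m2 (fineDom n Ω) *ᵥ v
      = f ⬝ᵥ u + (fun x => θ x * u x) ⬝ᵥ fineOpR n a m2 (fineDom n Ω) *ᵥ (fun x => θ x * u x) := by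
    rw [hv, form_sub (fineOpR_isSymm n a m2 (fineDom n Ω)) u (fun x => θ x * u x), hAu]
    have h0 : (fun x => θ x * u x) ⬝ᵥ f = 0 := by
      simp only [dotProduct]
      refine Finset.sum_eq_zero fun x _ => ?_
      have := hθf x
      rw [show θ x * u x * f x = (θ x * f x) * u x by ring, this, zero_mul]
    rw [h0, dotProduct_comm u f]
    ring
  have i5 : (fun x => θ x * u x) ⬝ᵥ fineOpR n a m2 (fineDom n Ω) *ᵥ (fun x => θ x * u x)
      = -(1 / 2) * ∑ x, ∑ x', fineOpR n a m2 (fineDom n Ω) x x' * (θ x - θ x') ^ 2 * (u x * u x') := by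
    have h1 := ims_identity (fineOpR_isSymm n a m2 (fineDom n Ω)) θ u
    have h0 : (fun x => θ x ^ 2 * u x) ⬝ᵥ fineOpR n a m2 (fineDom n Ω) *ᵥ u = 0 := by
      rw [hAu]
      simp only [dotProduct]
      refine Finset.sum_eq_zero fun x _ => ?_
      have := hθf x
      rw [show θ x ^ 2 * u x * f x = (θ x * f x) * (θ x * u x) by ring, this, zero_mul]
    linarith
  have i6 := ims_abs_le (fineOpR_isSymm n a m2 (fineDom n Ω)) θ u
  have i7 : ∑ x, u x ^ 2 * ∑ x', |fineOpR n a m2 (fineDom n Ω) x x'| * (θ x - θ x') ^ 2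
      ≤ ∑ x, u x ^ 2 * (if x ∈ layer2 n Ω Ω₀ then 2 * ((d : ℝ) + 1) + a else 0) :=
    Finset.sum_le_sum fun x _ => mul_le_mul_of_nonneg_left (ims_row_le hn ha.le x) (sq_nonneg _)
  have i8 : ∑ x, u x ^ 2 * (if x ∈ layer2 n Ω Ω₀ then 2 * ((d : ℝ) + 1) + a else 0)
      = (2 * ((d : ℝ) + 1) + a) * ∑ x ∈ layer2 n Ω Ω₀, u x ^ 2 := by
    simp_rw [mul_ite, mul_zero]
    rw [← Finset.sum_filter, Finset.filter_univ_mem, Finset.mul_sum]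
    exact Finset.sum_congr rfl fun x _ => by ring
  have i9 := neg_le_abs (∑ x, ∑ x', fineOpR n a m2 (fineDom n Ω) x x' * (θ x - θ x') ^ 2 * (u x * u x'))
  have e0 : f₀ ⬝ᵥ (fineOpR n a m2 (fineDom n Ω₀))⁻¹ *ᵥ f₀
      = f₀ ⬝ᵥ ((fineOpR n a m2 (fineDom n Ω₀))⁻¹ *ᵥ f₀) := rfl
  nlinarith [i1, i2, i3, i4, i5, i6, i7, i8, i9, ha]

end Diagonal

/-! ## §8  Combes–Thomas decay of `G_k(Ω,0)1_{B(y)}` over the boundary layer: the diagonal decay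
`D(1_{B(y)}, 1_{B(y)}) ≤ C₁·n^{d+1}·e^{−δ·dist(y, Ω₀ ∖ Ω)}` -/

section DiagonalDecay

variable {n : ℕ} {a m2 : ℝ} {Ω Ω₀ : Finset (Fin (d + 1) → ℤ)}

/-- the unit block of a fine point of `η^{-1}Ω`, as an element of `Ω`. [folklore] -/
def ublk (hn : 1 ≤ n) (x : ↥(fineDom n Ω)) : ↥Ω := ⟨blk n x.1, (mem_fineDom hn).1 x.2⟩

/-- the underlying site of the unit block of a fine point is `blk n x`. [folklore] -/
@[simp] theorem ublk_val (hn : 1 ≤ n) (x : ↥(fineDom n Ω)) : (ublk hn x).1 = blk n x.1 := rfl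

/-- **COMBES–THOMAS, BLOCK TO BLOCK**: the mass of `G_k(Ω,0)1_{B(y)}` on the block `B(yb)` is at most
`(2/min(2,a_k))²·e^{−2δ(|yb − y|_∞ − 1)}·n^{d+1}` (`B4RegionCov1518.green_setDecay_region_mass` — the fine blocks
over `y`, `yb` are at `η`-distance `≥ |yb − y|_∞ − 1`). [cite: CombesThomas1973, §II] [folklore] -/
theorem green_block_mass_le (hn : 1 ≤ n) (ha : 0 < a) (hm : 0 ≤ m2) {δ : ℝ} (hδ0 : 0 ≤ δ) (hδ1 : δ ≤ 1)
    (hsmall : 2 * ((d : ℝ) + 1) * δ ^ 2 + a * (Real.exp δ - 1) ≤ min 2 a / 2) (y yb : ↥Ω) :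
    ∑ x ∈ Finset.univ.filter (fun x : ↥(fineDom n Ω) => blk n x.1 = yb.1),
        ((fineOpR n a m2 (fineDom n Ω))⁻¹ *ᵥ blockInd n Ω y) x ^ 2
      ≤ (2 / min 2 a) ^ 2 * Real.exp (-(2 * (δ * (supNorm (yb.1 - y.1) - 1)))) * (n : ℝ) ^ (d + 1) := by
  classical
  set T := Finset.univ.filter (fun x : ↥(fineDom n Ω) => blk n x.1 = y.1) with hT
  have hTne : T.Nonempty := by
    refine ⟨⟨finePt n y.1 (fun _ => ⟨0, by omega⟩), finePt_mem_fineDom hn y.2 _⟩, ?_⟩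
    rw [hT, Finset.mem_filter]
    exact ⟨Finset.mem_univ _, blk_finePt hn y.1 _⟩
  have hρ : ∀ x ∈ Finset.univ.filter (fun x : ↥(fineDom n Ω) => blk n x.1 = yb.1), ∀ t ∈ T,
      supNorm (yb.1 - y.1) - 1 ≤ edistR n (fineDom n Ω) x t := by
    intro x hx t ht
    rw [Finset.mem_filter] at hx
    rw [hT, Finset.mem_filter] at ht
    have := edistR_ge_supNorm_blk hn (fineDom n Ω) x t
    rw [hx.2, ht.2] at this
    exact this
  have hg : ∀ x, x ∉ T → blockInd n Ω y x = 0 := by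
    intro x hx
    rw [blockInd_apply, if_neg]
    intro hb
    exact hx (by rw [hT, Finset.mem_filter]; exact ⟨Finset.mem_univ _, hb⟩)
  have h := green_setDecay_region_mass hn (fineDom_isBlockUnion hn Ω) ha hm hδ0 hδ1 hsmall _ T hTne _ hρ
    (blockInd n Ω y) hg
  have hsq : ∑ x, blockInd n Ω y x ^ 2 = (n : ℝ) ^ (d + 1) := by
    rw [← blockInd_sq hn y]
    unfold dotProduct
    exact Finset.sum_congr rfl fun x _ => sq _
  rw [hsq] at h
  exact h

/-- **COMBES–THOMAS OVER THE BOUNDARY LAYER**: for `δ ∈ (0, 1]` admissible,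
`Σ_{x ∈ layer} (G_k(Ω,0)1_{B(y)})(x)² ≤ (2/min(2,a_k))²e^{4δ}K_{d+1}(δ)·n^{d+1}·e^{−δ·dist(y, Ω₀ ∖ Ω)}`
(sum the block bound over the unit sites `yb` of the layer, all at sup-distance `≥ dist(y, Ω₀ ∖ Ω) − 2` from `y`,
against the lattice profile `B4Sect5Proof.latticeConst`). [cite: CombesThomas1973, §II] [folklore] -/
theorem green_layer_mass_le (hn : 1 ≤ n) (ha : 0 < a) (hm : 0 ≤ m2) {δ : ℝ} (hδ : 0 < δ) (hδ1 : δ ≤ 1)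
    (hsmall : 2 * ((d : ℝ) + 1) * δ ^ 2 + a * (Real.exp δ - 1) ≤ min 2 a / 2) (y : ↥Ω) :
    ∑ x ∈ layer2 n Ω Ω₀, ((fineOpR n a m2 (fineDom n Ω))⁻¹ *ᵥ blockInd n Ω y) x ^ 2
      ≤ (2 / min 2 a) ^ 2 * Real.exp (4 * δ) * latticeConst (d + 1) δ * (n : ℝ) ^ (d + 1)
          * Real.exp (-(δ * dSet (Ω₀ \ Ω) y.1)) := by
  classical
  set u := (fineOpR n a m2 (fineDom n Ω))⁻¹ *ᵥ blockInd n Ω y with hu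
  set N : ℝ := (n : ℝ) ^ (d + 1) with hN
  set ω := dSet (Ω₀ \ Ω) y.1 with hω
  set L₂ : Finset ↥Ω := Finset.univ.filter (fun yb => ∃ v ∈ Ω₀ \ Ω, supNorm (yb.1 - v) ≤ 2) with hL₂
  have hσ : 0 < min 2 a := lt_min (by norm_num) ha
  have hmaps : ∀ x ∈ layer2 n Ω Ω₀, ublk hn x ∈ L₂ := by
    intro x hx
    rw [mem_layer2] at hx
    rw [hL₂, Finset.mem_filter]
    exact ⟨Finset.mem_univ _, hx⟩
  rw [← Finset.sum_fiberwise_of_maps_to hmaps]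
  have step1 : ∀ yb ∈ L₂, ∑ x ∈ (layer2 n Ω Ω₀).filter (fun x => ublk hn x = yb), u x ^ 2
      ≤ (2 / min 2 a) ^ 2 * Real.exp (-(2 * (δ * (supNorm (yb.1 - y.1) - 1)))) * N := by
    intro yb _
    calc ∑ x ∈ (layer2 n Ω Ω₀).filter (fun x => ublk hn x = yb), u x ^ 2
        ≤ ∑ x ∈ Finset.univ.filter (fun x : ↥(fineDom n Ω) => blk n x.1 = yb.1), u x ^ 2 := by
          refine Finset.sum_le_sum_of_subset_of_nonneg (fun x hx => ?_) (fun _ _ _ => sq_nonneg _)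
          rw [Finset.mem_filter] at hx ⊢
          exact ⟨Finset.mem_univ _, by rw [← hx.2]; rfl⟩
      _ ≤ _ := green_block_mass_le hn ha hm hδ.le hδ1 hsmall y yb
  have step2 : ∀ yb ∈ L₂, Real.exp (-(2 * (δ * (supNorm (yb.1 - y.1) - 1))))
      ≤ Real.exp (4 * δ) * Real.exp (-(δ * ω)) * Real.exp (-(δ * rhoS Ω y yb)) := by
    intro yb hyb
    obtain ⟨v, hv, hv2⟩ := (Finset.mem_filter.1 hyb).2
    have h1 : ω ≤ supNorm (y.1 - yb.1) + 2 := by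
      have h3 := dSet_le y.1 hv
      have h2 := supNorm_add_le (y.1 - yb.1) (yb.1 - v)
      rw [sub_add_sub_cancel] at h2
      linarith
    have hsym : supNorm (yb.1 - y.1) = supNorm (y.1 - yb.1) := supNorm_sub_comm _ _
    rw [← Real.exp_add, ← Real.exp_add]
    apply Real.exp_le_exp.2
    unfold rhoS
    rw [hsym]
    nlinarith [supNorm_nonneg (y.1 - yb.1)]
  have step3 : ∀ yb ∈ L₂, ∑ x ∈ (layer2 n Ω Ω₀).filter (fun x => ublk hn x = yb), u x ^ 2
      ≤ (2 / min 2 a) ^ 2 * Real.exp (4 * δ) * N * Real.exp (-(δ * ω)) * Real.exp (-(δ * rhoS Ω y yb)) := by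
    intro yb hyb
    refine (step1 yb hyb).trans ?_
    have := mul_le_mul_of_nonneg_left (step2 yb hyb) (show 0 ≤ (2 / min 2 a) ^ 2 * N by positivity)
    nlinarith
  have hsum := rhoS_sumBound Ω δ hδ y
  have hK : ∑ yb ∈ L₂, Real.exp (-(δ * rhoS Ω y yb)) ≤ latticeConst (d + 1) δ :=
    (Finset.sum_le_univ_sum_of_nonneg fun _ => (Real.exp_pos _).le).trans hsum
  calc ∑ yb ∈ L₂, ∑ x ∈ (layer2 n Ω Ω₀).filter (fun x => ublk hn x = yb), u x ^ 2
      ≤ ∑ yb ∈ L₂, (2 / min 2 a) ^ 2 * Real.exp (4 * δ) * N * Real.exp (-(δ * ω))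
          * Real.exp (-(δ * rhoS Ω y yb)) := Finset.sum_le_sum step3
    _ = (2 / min 2 a) ^ 2 * Real.exp (4 * δ) * N * Real.exp (-(δ * ω))
          * ∑ yb ∈ L₂, Real.exp (-(δ * rhoS Ω y yb)) := by rw [Finset.mul_sum]
    _ ≤ (2 / min 2 a) ^ 2 * Real.exp (4 * δ) * N * Real.exp (-(δ * ω)) * latticeConst (d + 1) δ :=
        mul_le_mul_of_nonneg_left hK (by positivity)
    _ = _ := by ring

/-- **THE DIAGONAL DECAY CONSTANT** `C₁(d, a_k, δ) = ((d+1) + a_k/2)(2/min(2,a_k))²e^{4δ}K_{d+1}(δ) + e^{2δ}/min(2,a_k)`.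
[folklore] -/
def cDiag (d : ℕ) (a δ : ℝ) : ℝ :=
  (((d : ℝ) + 1) + a / 2) * ((2 / min 2 a) ^ 2 * Real.exp (4 * δ) * latticeConst (d + 1) δ)
    + Real.exp (2 * δ) / min 2 a

/-- the diagonal decay constant is nonnegative. [folklore] -/
theorem cDiag_nonneg (d : ℕ) {a δ : ℝ} (ha : 0 < a) (hδ : 0 ≤ δ) : 0 ≤ cDiag d a δ := by
  have hσ : 0 < min 2 a := lt_min (by norm_num) ha
  have hK : 0 ≤ latticeConst (d + 1) δ := latticeConst_nonneg _ hδ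
  unfold cDiag
  positivity

/-- **THE DIAGONAL DECAY**: for nested block unions `Ω ⊆ Ω₀`, every unit site `y ∈ Ω` and every admissible
`δ ∈ (0, 1]`: `D(1_{B(y)}, 1_{B(y)}) ≤ C₁·n^{d+1}·e^{−δ·dist_∞(y, Ω₀ ∖ Ω)}` (IMS diagonal estimate + Combes–Thomas
over the layer for `dist ≥ 2`; the trivial bound `≤ n^{d+1}/min(2,a_k)` for `dist < 2`). [folklore] -/
theorem Dform_diag_decay (hn : 1 ≤ n) (ha : 0 < a) (hm : 0 ≤ m2) (h : Ω ⊆ Ω₀) {δ : ℝ} (hδ : 0 < δ)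
    (hδ1 : δ ≤ 1) (hsmall : 2 * ((d : ℝ) + 1) * δ ^ 2 + a * (Real.exp δ - 1) ≤ min 2 a / 2) (y : ↥Ω) :
    Dform n a m2 Ω Ω₀ (blockInd n Ω y) (blockInd n Ω y)
      ≤ cDiag d a δ * (n : ℝ) ^ (d + 1) * Real.exp (-(δ * dSet (Ω₀ \ Ω) y.1)) := by
  have hσ : 0 < min 2 a := lt_min (by norm_num) ha
  have hK : 0 ≤ latticeConst (d + 1) δ := latticeConst_nonneg _ hδ.le
  set ω := dSet (Ω₀ \ Ω) y.1 with hω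
  have hω0 : 0 ≤ ω := dSet_nonneg _ _
  set N : ℝ := (n : ℝ) ^ (d + 1) with hN
  have hN : 0 < N := by positivity
  have t1 : 0 ≤ (((d : ℝ) + 1) + a / 2) * ((2 / min 2 a) ^ 2 * Real.exp (4 * δ) * latticeConst (d + 1) δ)
      * N * Real.exp (-(δ * ω)) := by positivity
  have t2 : 0 ≤ Real.exp (2 * δ) / min 2 a * N * Real.exp (-(δ * ω)) := by positivity
  by_cases hy : 2 ≤ ω
  · have h1 := Dform_diag_le_layer hn ha hm h y hy
    have h2 := green_layer_mass_le (Ω₀ := Ω₀) hn ha hm hδ hδ1 hsmall y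
    calc Dform n a m2 Ω Ω₀ (blockInd n Ω y) (blockInd n Ω y)
        ≤ (((d : ℝ) + 1) + a / 2) * ((2 / min 2 a) ^ 2 * Real.exp (4 * δ) * latticeConst (d + 1) δ * N
            * Real.exp (-(δ * ω))) := h1.trans (mul_le_mul_of_nonneg_left h2 (by positivity))
      _ ≤ cDiag d a δ * N * Real.exp (-(δ * ω)) := by
          unfold cDiag
          nlinarith
  · push Not at hy
    have h1 := Dform_self_le hn ha hm Ω₀ (blockInd n Ω y)
    rw [blockInd_sq hn y] at h1
    have h2 : 1 ≤ Real.exp (2 * δ) * Real.exp (-(δ * ω)) := by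
      rw [← Real.exp_add]
      exact Real.one_le_exp (by nlinarith)
    calc Dform n a m2 Ω Ω₀ (blockInd n Ω y) (blockInd n Ω y) ≤ N / min 2 a := h1
      _ ≤ Real.exp (2 * δ) / min 2 a * N * Real.exp (-(δ * ω)) := by
          rw [div_eq_mul_inv, div_eq_mul_inv]
          have : 0 ≤ N * (min 2 a)⁻¹ := by positivity
          nlinarith
      _ ≤ cDiag d a δ * N * Real.exp (-(δ * ω)) := by
          unfold cDiag
          nlinarith

end DiagonalDecay

/-! ## §9  (5.5): `|Δ^{(k)}(Ω,0)(y,y′) − Δ^{(k)}(Ω₀,0)(y,y′)| ≤ c·e^{−δ(|y−y′| + dist(y,Ω₀∖Ω) + dist(y′,Ω₀∖Ω))}` -/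

section Keff55

variable {n : ℕ} {a m2 : ℝ} {Ω Ω₀ : Finset (Fin (d + 1) → ℤ)}

/-- **THE OFF-DIAGONAL DECAY OF `D` ON BLOCK INDICATORS**: Cauchy–Schwarz in the nonnegative form `D`
(`|D(f,g)|² ≤ D(f,f)D(g,g)`, giving `e^{−δ(ω(y)+ω(y′))/2}`) interpolated with the Combes–Thomas bound on each
pairing (`B4RegionCov1518.blockPairing_bound`, giving `e^{−δ|y−y′|}`):
`|D(1_{B(y)}, 1_{B(y′)})| ≤ ((C₁ + 2(2/min(2,a_k))e^δ)/2)·n^{d+1}·e^{−(δ/4)(|y−y′|_∞ + ω(y) + ω(y′))}`. [folklore] -/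
theorem Dform_offdiag_decay (hn : 1 ≤ n) (ha : 0 < a) (hm : 0 ≤ m2) (h : Ω ⊆ Ω₀) {δ : ℝ} (hδ : 0 < δ)
    (hδ1 : δ ≤ 1) (hsmall : 2 * ((d : ℝ) + 1) * δ ^ 2 + a * (Real.exp δ - 1) ≤ min 2 a / 2) (y y' : ↥Ω) :
    |Dform n a m2 Ω Ω₀ (blockInd n Ω y) (blockInd n Ω y')|
      ≤ (cDiag d a δ + 2 * (2 / min 2 a) * Real.exp δ) / 2 * (n : ℝ) ^ (d + 1)
          * Real.exp (-(δ / 4 * (supNorm (y.1 - y'.1) + dSet (Ω₀ \ Ω) y.1 + dSet (Ω₀ \ Ω) y'.1))) := by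
  have hσ : 0 < min 2 a := lt_min (by norm_num) ha
  have hC := cDiag_nonneg d ha hδ.le
  set D := Dform n a m2 Ω Ω₀ (blockInd n Ω y) (blockInd n Ω y') with hD
  set ω := dSet (Ω₀ \ Ω) y.1 with hω
  set ω' := dSet (Ω₀ \ Ω) y'.1 with hω'
  set s := supNorm (y.1 - y'.1) with hs
  have hω0 : 0 ≤ ω := dSet_nonneg _ _
  have hω0' : 0 ≤ ω' := dSet_nonneg _ _
  have hs0 : 0 ≤ s := supNorm_nonneg _
  set N : ℝ := (n : ℝ) ^ (d + 1) with hN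
  have hN : 0 < N := by positivity
  -- the Cauchy–Schwarz bound
  have hyy := Dform_diag_decay hn ha hm h hδ hδ1 hsmall y
  have hy'y' := Dform_diag_decay hn ha hm h hδ hδ1 hsmall y'
  have hsq := Dform_sq_le hn ha hm h (blockInd n Ω y) (blockInd n Ω y')
  have hE1 : Real.exp (-(δ / 2 * (ω + ω'))) ^ 2 = Real.exp (-(δ * ω)) * Real.exp (-(δ * ω')) := by
    rw [sq, ← Real.exp_add, ← Real.exp_add]
    congr 1
    ring
  have hP : |D| ≤ cDiag d a δ * N * Real.exp (-(δ / 2 * (ω + ω'))) := by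
    refine abs_le_of_sq_le_sq ?_ (by positivity)
    calc D ^ 2 ≤ Dform n a m2 Ω Ω₀ (blockInd n Ω y) (blockInd n Ω y)
          * Dform n a m2 Ω Ω₀ (blockInd n Ω y') (blockInd n Ω y') := hsq
      _ ≤ (cDiag d a δ * N * Real.exp (-(δ * ω))) * (cDiag d a δ * N * Real.exp (-(δ * ω'))) :=
          mul_le_mul hyy hy'y' (Dform_self_nonneg hn ha hm h _) (by positivity)
      _ = (cDiag d a δ * N * Real.exp (-(δ / 2 * (ω + ω')))) ^ 2 := by
          rw [mul_pow, hE1]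
          ring
  -- the Combes–Thomas bound on each pairing
  have hQ : |D| ≤ 2 * (N * (2 / min 2 a) * Real.exp δ) * Real.exp (-(δ * s)) := by
    rw [hD, Dform_blockInd hn h]
    have b1 := blockPairing_bound hn ha hm hδ.le hδ1 hsmall Ω y y'
    have b2 := blockPairing_bound hn ha hm hδ.le hδ1 hsmall Ω₀ (incl h y) (incl h y')
    simp only [incl_val] at b2
    calc |(indR n Ω * (fineOpR n a m2 (fineDom n Ω))⁻¹ * (indR n Ω)ᵀ) y y'
          - (indR n Ω₀ * (fineOpR n a m2 (fineDom n Ω₀))⁻¹ * (indR n Ω₀)ᵀ) (incl h y) (incl h y')|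
        ≤ |(indR n Ω * (fineOpR n a m2 (fineDom n Ω))⁻¹ * (indR n Ω)ᵀ) y y'|
          + |(indR n Ω₀ * (fineOpR n a m2 (fineDom n Ω₀))⁻¹ * (indR n Ω₀)ᵀ) (incl h y) (incl h y')| :=
          abs_sub _ _
      _ ≤ N * (2 / min 2 a) * Real.exp δ * Real.exp (-(δ * s))
          + N * (2 / min 2 a) * Real.exp δ * Real.exp (-(δ * s)) := add_le_add b1 b2
      _ = _ := by ring
  -- interpolation
  have hE : Real.exp (-(δ / 2 * (ω + ω'))) * Real.exp (-(δ * s))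
      ≤ Real.exp (-(δ / 4 * (s + ω + ω'))) ^ 2 := by
    rw [← Real.exp_add, sq, ← Real.exp_add]
    apply Real.exp_le_exp.2
    nlinarith
  have amgm : ∀ p q : ℝ, p * q ≤ ((p + q) / 2) ^ 2 := fun p q => by nlinarith [sq_nonneg (p - q)]
  have hD0 := abs_nonneg D
  have hPQ : |D| * |D| ≤ (cDiag d a δ * N * Real.exp (-(δ / 2 * (ω + ω'))))
      * (2 * (N * (2 / min 2 a) * Real.exp δ) * Real.exp (-(δ * s))) :=
    mul_le_mul hP hQ hD0 (by positivity)
  refine abs_le_of_sq_le_sq ?_ (by positivity)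
  calc D ^ 2 = |D| * |D| := by rw [← sq, sq_abs]
    _ ≤ (cDiag d a δ * N * Real.exp (-(δ / 2 * (ω + ω'))))
          * (2 * (N * (2 / min 2 a) * Real.exp δ) * Real.exp (-(δ * s))) := hPQ
    _ = (cDiag d a δ * N) * (2 * (2 / min 2 a) * Real.exp δ * N)
          * (Real.exp (-(δ / 2 * (ω + ω'))) * Real.exp (-(δ * s))) := by ring
    _ ≤ (cDiag d a δ * N) * (2 * (2 / min 2 a) * Real.exp δ * N)
          * Real.exp (-(δ / 4 * (s + ω + ω'))) ^ 2 := mul_le_mul_of_nonneg_left hE (by positivity)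
    _ ≤ ((cDiag d a δ * N + 2 * (2 / min 2 a) * Real.exp δ * N) / 2) ^ 2
          * Real.exp (-(δ / 4 * (s + ω + ω'))) ^ 2 := mul_le_mul_of_nonneg_right (amgm _ _) (sq_nonneg _)
    _ = _ := by ring

/-- **(5.5) AT A FIXED ADMISSIBLE RATE**: for nested block unions `Ω ⊆ Ω₀`, `n ≥ 1`, `a_k > 0`, `m² ≥ 0`, every
admissible `δ ∈ (0,1]` and all unit sites `y, y′ ∈ Ω`:
`|Δ^{(k)}(Ω,0)(y,y′) − Δ^{(k)}(Ω₀,0)(y,y′)| ≤ a_k²·((C₁ + 2(2/min(2,a_k))e^δ)/2)·e^{−(δ/4)(|y−y′|_∞ + dist(y,Ω₀∖Ω) + dist(y′,Ω₀∖Ω))}`.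
[cite: Balaban1983RegularityDecay, p. 594 (5.5), case A = 0] -/
theorem keff55_region_rate (hn : 1 ≤ n) (ha : 0 < a) (hm : 0 ≤ m2) (h : Ω ⊆ Ω₀) {δ : ℝ} (hδ : 0 < δ)
    (hδ1 : δ ≤ 1) (hsmall : 2 * ((d : ℝ) + 1) * δ ^ 2 + a * (Real.exp δ - 1) ≤ min 2 a / 2) (y y' : ↥Ω) :
    |KeffR n a m2 Ω y y' - KeffR n a m2 Ω₀ (incl h y) (incl h y')|
      ≤ a ^ 2 * ((cDiag d a δ + 2 * (2 / min 2 a) * Real.exp δ) / 2)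
          * Real.exp (-(δ / 4 * (supNorm (y.1 - y'.1) + dSet (Ω₀ \ Ω) y.1 + dSet (Ω₀ \ Ω) y'.1))) := by
  have hN : 0 < (n : ℝ) ^ (d + 1) := by positivity
  have hb := Dform_offdiag_decay hn ha hm h hδ hδ1 hsmall y y'
  rw [KeffR_sub_eq hn h, abs_mul, abs_neg, abs_of_nonneg (by positivity : 0 ≤ a ^ 2 * ((n : ℝ) ^ (d + 1))⁻¹)]
  calc a ^ 2 * ((n : ℝ) ^ (d + 1))⁻¹ * |Dform n a m2 Ω Ω₀ (blockInd n Ω y) (blockInd n Ω y')|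
      ≤ a ^ 2 * ((n : ℝ) ^ (d + 1))⁻¹ * ((cDiag d a δ + 2 * (2 / min 2 a) * Real.exp δ) / 2 * (n : ℝ) ^ (d + 1)
          * Real.exp (-(δ / 4 * (supNorm (y.1 - y'.1) + dSet (Ω₀ \ Ω) y.1 + dSet (Ω₀ \ Ω) y'.1)))) :=
        mul_le_mul_of_nonneg_left hb (by positivity)
    _ = _ := by
        field_simp

/-- **B4 (5.5) AT `A = 0` FOR NESTED BLOCK UNIONS, UNIFORMLY ON THE WINDOW — HYPOTHESIS-FREE.**  For every
dimension `d + 1` and window `a_k ∈ [a₋, a₊]` (`a₋ > 0`) there are `δ, c > 0` (explicitly `δ = ctRate d a₋ a₊/4`)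
such that for EVERY `n ≥ 1`, every `a_k` of the window, every `m² ≥ 0`, EVERY nested pair `Ω ⊆ Ω₀` of finite
sets of unit sites (fine regions `η^{-1}Ω ⊆ η^{-1}Ω₀`, unions of unit blocks) and all `y, y′ ∈ Ω`:
`|Δ^{(k)}(Ω, 0)(y, y′) − Δ^{(k)}(Ω₀, 0)(y, y′)| ≤ c·exp(−δ(|y − y′|_∞ + dist_∞(y, Ω₀ ∖ Ω) + dist_∞(y′, Ω₀ ∖ Ω)))`.
[cite: Balaban1983RegularityDecay, p. 594 (5.5) («|(Δ^{(k)}(Ω, A) − Δ^{(k)}(Ω₀, A))(x, x′)|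
≤ c₀e^{−δ₀(|x−x′|+dist(x, Ω^{(k)c})+dist(x′, Ω^{(k)c}))}, Ω ⊂ Ω₀, x, x′∈Ω^{(k)}»), case A = 0, `Ω^{(k)c}` read as
`Ω₀^{(k)} ∖ Ω^{(k)}` (dictionary)] -/
theorem keff55_region (d : ℕ) (amin aplus : ℝ) (ha : 0 < amin) :
    ∃ δ c : ℝ, 0 < δ ∧ 0 < c ∧ δ = ctRate d amin aplus / 4 ∧
      ∀ (n : ℕ), 1 ≤ n → ∀ (a m2 : ℝ), amin ≤ a → a ≤ aplus → 0 ≤ m2 →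
        ∀ (Ω Ω₀ : Finset (Fin (d + 1) → ℤ)) (h : Ω ⊆ Ω₀) (y y' : ↥Ω),
          |KeffR n a m2 Ω y y' - KeffR n a m2 Ω₀ (incl h y) (incl h y')|
            ≤ c * Real.exp (-(δ * (supNorm (y.1 - y'.1) + dSet (Ω₀ \ Ω) y.1 + dSet (Ω₀ \ Ω) y'.1))) := by
  set κ := ctRate d amin aplus with hκdef
  have hκ : 0 < κ := ctRate_pos d aplus ha
  have hκ1 : κ ≤ 1 := ctRate_le_one d amin aplus
  have hσ : 0 < min 2 amin := lt_min (by norm_num) ha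
  have hK : 0 ≤ latticeConst (d + 1) κ := latticeConst_nonneg _ hκ.le
  set CU : ℝ := (((d : ℝ) + 1) + |aplus| / 2) * ((2 / min 2 amin) ^ 2 * Real.exp (4 * κ) * latticeConst (d + 1) κ)
    + Real.exp (2 * κ) / min 2 amin + 2 * (2 / min 2 amin) * Real.exp κ with hCU
  have hCU0 : 0 ≤ CU := by positivity
  refine ⟨κ / 4, aplus ^ 2 * (CU / 2) + 1, by positivity, by positivity, rfl, ?_⟩
  intro n hn a m2 h1 h2 h3 Ω Ω₀ h y y'
  have ha0 : 0 < a := lt_of_lt_of_le ha h1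
  have hσa : 0 < min 2 a := lt_min (by norm_num) ha0
  have hsmall := ctRate_small d ha h1 h2
  have hb := keff55_region_rate hn ha0 h3 h hκ hκ1 hsmall y y'
  refine hb.trans (mul_le_mul_of_nonneg_right ?_ (Real.exp_pos _).le)
  -- the constant at `a` is dominated by the window constant
  have hmin : min 2 amin ≤ min 2 a := min_le_min le_rfl h1
  have hdiv : 2 / min 2 a ≤ 2 / min 2 amin := div_le_div_of_nonneg_left (by norm_num) hσ hmin
  have hdiv0 : 0 ≤ 2 / min 2 a := by positivity
  have hsq : (2 / min 2 a) ^ 2 ≤ (2 / min 2 amin) ^ 2 := pow_le_pow_left₀ hdiv0 hdiv 2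
  have haabs : a ≤ |aplus| := h2.trans (le_abs_self _)
  have hC1 : cDiag d a κ ≤ (((d : ℝ) + 1) + |aplus| / 2) * ((2 / min 2 amin) ^ 2 * Real.exp (4 * κ)
      * latticeConst (d + 1) κ) + Real.exp (2 * κ) / min 2 amin := by
    unfold cDiag
    refine add_le_add ?_ ?_
    · refine mul_le_mul (by linarith) ?_ (by positivity) (by positivity)
      exact mul_le_mul_of_nonneg_right (mul_le_mul_of_nonneg_right hsq (Real.exp_pos _).le) hK
    · exact div_le_div_of_nonneg_left (Real.exp_pos _).le hσ hmin
  have hC2 : 2 * (2 / min 2 a) * Real.exp κ ≤ 2 * (2 / min 2 amin) * Real.exp κ := by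
    refine mul_le_mul_of_nonneg_right ?_ (Real.exp_pos _).le
    linarith
  have hC : cDiag d a κ + 2 * (2 / min 2 a) * Real.exp κ ≤ CU := by rw [hCU]; linarith
  have hCa0 : 0 ≤ cDiag d a κ + 2 * (2 / min 2 a) * Real.exp κ := by
    have := cDiag_nonneg d ha0 hκ.le
    positivity
  have ha2 : a ^ 2 ≤ aplus ^ 2 := pow_le_pow_left₀ ha0.le h2 2
  have := mul_le_mul ha2 (div_le_div_of_nonneg_right hC (by norm_num : (0:ℝ) ≤ 2)) (by positivity)
    (by positivity)
  linarith

end Keff55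

/-! ## §10  (1.19)–(1.20): `δC_Λ^{(k)}(Ω, Ω₀) = C_Λ^{(k)}(Ω) − C_Λ^{(k)}(Ω₀)` for nested block unions, by the
Section 5 Theorem (5.10) -/

section Cov120

variable {Ω Ω₀ : Finset (Fin (d + 1) → ℤ)}

/-- the `L`-block averaging projection of `Ω₀^{(k)}` restricted to `Ω^{(k)} ⊆ Ω₀^{(k)}` is that of `Ω^{(k)}` (its
entries only depend on the two sites). [folklore] -/
theorem projL_submatrix_incl (L : ℕ) (h : Ω ⊆ Ω₀) :
    (projL L Ω₀).submatrix (incl h) (incl h) = projL L Ω := by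
  ext y y'
  rfl

/-- `(Δ^{(k)}(Ω₀,0) + aL^{-2}P(0))|_{Ω^{(k)}} = Δ^{(k)}(Ω₀,0)|_{Ω^{(k)}} + aL^{-2}P_Ω(0)`. [folklore] -/
theorem covR_submatrix_incl (n L : ℕ) (a₁ a₂ m2 : ℝ) (h : Ω ⊆ Ω₀) :
    (covR n L a₁ a₂ m2 Ω₀).submatrix (incl h) (incl h)
      = (KeffR n a₁ m2 Ω₀).submatrix (incl h) (incl h) + (a₂ / (L : ℝ) ^ 2) • projL L Ω := by
  rw [← projL_submatrix_incl L h]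
  rfl

/-- the sup-distance of `Ω₀^{(k)}` restricted to `Ω^{(k)}` is the sup-distance of `Ω^{(k)}`. [folklore] -/
theorem rhoS_incl (h : Ω ⊆ Ω₀) : (fun y y' => rhoS Ω₀ (incl h y) (incl h y')) = rhoS Ω := rfl

/-- **B4 (1.19)–(1.20) AT `A = 0` FOR NESTED BLOCK UNIONS AND EVERY `Λ ⊆ Ω^{(k)}` — KERNEL-CHECKED,
HYPOTHESIS-FREE** [Balaban, CMP 89 (1983), p. 574 (1.19)–(1.20) at `A = 0`, via p. 594: (5.5) + the Section 5
Theorem (5.10)].  For `d`, `L = ℓ + 1 ≥ 2` and a window `a_k ∈ [a₋,a₊]`, `m_k² ∈ [0,m²₊]`, `a ∈ [a2₋, a2₊]`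
(`a₋, a2₋ > 0`) there are `δ, c > 0` such that for EVERY `n ≥ 1` (`η = 1/n`; in the print `n = L^k`), every
admissible `a_k, m², a`, EVERY nested pair `Ω ⊆ Ω₀` of finite unions of `L`-blocks of unit sites (so that `Ω` and
`Ω₀` read as the fine regions `η^{-1}Ω = B^k(Ω^{(k)}) ⊆ η^{-1}Ω₀`), every set `Λ ⊆ Ω^{(k)}` of unit sites (an
injection `e`) and all `x, x′ ∈ Λ`:
`|δC_Λ^{(k)}(Ω, Ω₀; x, x′)| = |C_Λ^{(k)}(Ω; x, x′) − C_Λ^{(k)}(Ω₀; x, x′)|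
   ≤ c·exp(−δ(|x − x′|_∞ + dist_∞(x, Ω₀^{(k)} ∖ Ω^{(k)}) + dist_∞(x′, Ω₀^{(k)} ∖ Ω^{(k)})))`,
where `C_Λ^{(k)}(Ω) = ((Δ^{(k)}(Ω,0) + aL^{-2}P(0))|_Λ)^{-1}` (`B4RegionCov1518.covRSub`) and `C_Λ^{(k)}(Ω₀)` is the
same for `Ω₀` with `Λ ↪ Ω₀^{(k)}` (`e ↦ ι ∘ e`).  Constants uniform in `n`, both regions, `Λ` and the window.
Proof = the print's route: (5.5) (`keff55_region`) is (5.9) for `B = Δ^{(k)}(Ω) − Δ^{(k)}(Ω₀)|_{Ω^{(k)}}` with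
`ω = dist(·, Ω₀^{(k)}∖Ω^{(k)})`; (5.6) for both operators is `B4RegionCov1518.covR_hyp56`; the Section 5 Theorem
(5.10) is `B4Sect5Torus.perturb_bound`.
[cite: Balaban1983RegularityDecay, p. 574 (1.19) («δC_Λ^{(k)}(Ω, Ω₀, A) = C_Λ^{(k)}(Ω, A) − C_Λ^{(k)}(Ω₀, A)»),
(1.20) («|δC_Λ^{(k)}(Ω, Ω₀, A; x, x′)| ≤ c₀ exp(−δ₀(|x−x′| + dist(x, Ω^{(k)c}) + dist(x′, Ω^{(k)c}))), x, x′∈Λ»);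
p. 594 (5.5)–(5.10); case A = 0] -/
theorem cov120_region_sub_delta (d ℓ : ℕ) (hℓ : 1 ≤ ℓ) (amin aplus m2max a2min a2plus : ℝ)
    (ha : 0 < amin) (ha2 : 0 < a2min) :
    ∃ δ c : ℝ, 0 < δ ∧ 0 < c ∧ ∀ (n : ℕ), 1 ≤ n → ∀ (a₁ m2 a₂ : ℝ), amin ≤ a₁ → a₁ ≤ aplus → 0 ≤ m2 →
      m2 ≤ m2max → a2min ≤ a₂ → a₂ ≤ a2plus →
      ∀ (Ω Ω₀ : Finset (Fin (d + 1) → ℤ)), IsBlockUnion (ℓ + 1) Ω → IsBlockUnion (ℓ + 1) Ω₀ →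
        ∀ (h : Ω ⊆ Ω₀) {m : Type*} [Fintype m] [DecidableEq m] (e : m → ↥Ω), Function.Injective e →
          ∀ i i' : m,
            |(covRSub n (ℓ + 1) a₁ a₂ m2 Ω e)⁻¹ i i' - (covRSub n (ℓ + 1) a₁ a₂ m2 Ω₀ (incl h ∘ e))⁻¹ i i'|
              ≤ c * Real.exp (-(δ * (supNorm ((e i).1 - (e i').1)
                  + dSet (Ω₀ \ Ω) (e i).1 + dSet (Ω₀ \ Ω) (e i').1))) := by
  obtain ⟨γ₀, c₀, κ, hγ, hc, hκ, -, -, hA⟩ := covR_hyp56 d ℓ hℓ amin aplus m2max a2min a2plus ha ha2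
  obtain ⟨δK, cK, hδK, hcK, -, hB⟩ := keff55_region d amin aplus ha
  have hKn : ∀ a : ℝ, 0 < a → 0 ≤ latticeConst (d + 1) a := fun a ha => latticeConst_nonneg (d + 1) ha.le
  set δ₀ := min κ δK with hδ₀
  have hδ₀pos : 0 < δ₀ := lt_min hκ hδK
  set c₁ := c₀ + cK + 1 with hc₁
  have hc₁pos : 0 < c₁ := by positivity
  have hBC := bigC_nonneg hKn hγ hc₁pos.le hδ₀pos (K := latticeConst (d + 1))
  refine ⟨rate (latticeConst (d + 1)) γ₀ c₁ δ₀ / 4, bigC (latticeConst (d + 1)) γ₀ c₁ δ₀ + 1,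
    by have := rate_pos hKn hγ hc₁pos.le hδ₀pos; positivity, by positivity, ?_⟩
  intro n hn a₁ m2 a₂ h1 h2 h3 h4 h5 h6 Ω Ω₀ hΩ hΩ₀ h m _ _ e he i i'
  -- the two operators `A = (Δ^{(k)}(Ω₀) + aL⁻²P)|_{Ω^{(k)}}` and `A + B = Δ^{(k)}(Ω) + aL⁻²P`
  set A := (covR n (ℓ + 1) a₁ a₂ m2 Ω₀).submatrix (incl h) (incl h) with hAdef
  set B := KeffR n a₁ m2 Ω - (KeffR n a₁ m2 Ω₀).submatrix (incl h) (incl h) with hBdef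
  have hAB : A + B = covR n (ℓ + 1) a₁ a₂ m2 Ω := by
    rw [hAdef, hBdef, covR_submatrix_incl n (ℓ + 1) a₁ a₂ m2 h, covR]
    abel
  -- (5.6) for both, with the common constants `γ₀, c₁, δ₀`
  have hρnn : ∀ p q : ↥Ω, 0 ≤ rhoS Ω p q := fun p q => (rhoS_isPseudoDist Ω).nonneg p q
  have h56A : Hyp56 (rhoS Ω) A γ₀ c₁ δ₀ := by
    have h0 := hyp56_submatrix (hA n hn a₁ m2 a₂ h1 h2 h3 h4 h5 h6 Ω₀ hΩ₀) (incl_injective h)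
    rw [rhoS_incl h] at h0
    exact B4TwoBox120.hyp56_weaken hρnn h0 hc (by rw [hc₁]; linarith) (min_le_left _ _)
  have h56AB : Hyp56 (rhoS Ω) (A + B) γ₀ c₁ δ₀ := by
    rw [hAB]
    exact B4TwoBox120.hyp56_weaken hρnn (hA n hn a₁ m2 a₂ h1 h2 h3 h4 h5 h6 Ω hΩ) hc (by rw [hc₁]; linarith)
      (min_le_left _ _)
  -- (5.9) for `B` with `ω = dist(·, Ω₀^{(k)} ∖ Ω^{(k)})`: this is (5.5)
  have h59 : Hyp59 (rhoS Ω) (fun y : ↥Ω => dSet (Ω₀ \ Ω) y.1) B c₁ δ₀ := by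
    intro p q
    have hb := hB n hn a₁ m2 h1 h2 h3 Ω Ω₀ h p q
    have hBpq : B p q = KeffR n a₁ m2 Ω p q - KeffR n a₁ m2 Ω₀ (incl h p) (incl h q) := by
      rw [hBdef, Matrix.sub_apply, Matrix.submatrix_apply]
    rw [hBpq]
    refine hb.trans ?_
    have hT : 0 ≤ rhoS Ω p q + dSet (Ω₀ \ Ω) p.1 + dSet (Ω₀ \ Ω) q.1 := by
      have := dSet_nonneg (Ω₀ \ Ω) p.1
      have := dSet_nonneg (Ω₀ \ Ω) q.1
      have := hρnn p q
      positivity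
    have e1 : Real.exp (-(δK * (rhoS Ω p q + dSet (Ω₀ \ Ω) p.1 + dSet (Ω₀ \ Ω) q.1)))
        ≤ Real.exp (-(δ₀ * (rhoS Ω p q + dSet (Ω₀ \ Ω) p.1 + dSet (Ω₀ \ Ω) q.1))) :=
      Real.exp_le_exp.2 (by nlinarith [min_le_right κ δK])
    unfold rhoS at e1 hT ⊢
    calc cK * Real.exp (-(δK * (supNorm (p.1 - q.1) + dSet (Ω₀ \ Ω) p.1 + dSet (Ω₀ \ Ω) q.1)))
        ≤ cK * Real.exp (-(δ₀ * (supNorm (p.1 - q.1) + dSet (Ω₀ \ Ω) p.1 + dSet (Ω₀ \ Ω) q.1))) :=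
          mul_le_mul_of_nonneg_left e1 hcK.le
      _ ≤ c₁ * Real.exp (-(δ₀ * (supNorm (p.1 - q.1) + dSet (Ω₀ \ Ω) p.1 + dSet (Ω₀ \ Ω) q.1))) :=
          mul_le_mul_of_nonneg_right (by rw [hc₁]; linarith) (Real.exp_pos _).le
  -- the Section 5 Theorem (5.10)
  have hP := perturb_bound hKn hγ hc₁pos hδ₀pos (rhoS_isPseudoDist Ω) (rhoS_sumBound Ω) h56A h56AB
    (fun y => dSet_nonneg (Ω₀ \ Ω) y.1) (fun x y => dSet_lip (Ω₀ \ Ω) x.1 y.1) h59 he i i'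
  have hsubA : A.submatrix e e = covRSub n (ℓ + 1) a₁ a₂ m2 Ω₀ (incl h ∘ e) := by
    rw [hAdef, Matrix.submatrix_submatrix]
    rfl
  have hsubAB : (A + B).submatrix e e = covRSub n (ℓ + 1) a₁ a₂ m2 Ω e := by
    rw [hAB]
    rfl
  rw [hsubA, hsubAB, abs_sub_comm] at hP
  refine hP.trans ?_
  exact mul_le_mul_of_nonneg_right (le_add_of_nonneg_right zero_le_one) (Real.exp_pos _).le

/-- **(1.20) with `Λ = Ω^{(k)}` (no restriction)**: `|C^{(k)}(Ω; y, y′) − C_{Ω^{(k)}}^{(k)}(Ω₀; y, y′)|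
≤ c e^{−δ(|y−y′| + ω(y) + ω(y′))}`. [cite: Balaban1983RegularityDecay, p. 574 (1.19)–(1.20), case A = 0] -/
theorem cov120_region_delta (d ℓ : ℕ) (hℓ : 1 ≤ ℓ) (amin aplus m2max a2min a2plus : ℝ)
    (ha : 0 < amin) (ha2 : 0 < a2min) :
    ∃ δ c : ℝ, 0 < δ ∧ 0 < c ∧ ∀ (n : ℕ), 1 ≤ n → ∀ (a₁ m2 a₂ : ℝ), amin ≤ a₁ → a₁ ≤ aplus → 0 ≤ m2 →
      m2 ≤ m2max → a2min ≤ a₂ → a₂ ≤ a2plus →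
      ∀ (Ω Ω₀ : Finset (Fin (d + 1) → ℤ)), IsBlockUnion (ℓ + 1) Ω → IsBlockUnion (ℓ + 1) Ω₀ →
        ∀ (h : Ω ⊆ Ω₀) (y y' : ↥Ω),
          |(covR n (ℓ + 1) a₁ a₂ m2 Ω)⁻¹ y y' - (covRSub n (ℓ + 1) a₁ a₂ m2 Ω₀ (incl h))⁻¹ y y'|
            ≤ c * Real.exp (-(δ * (supNorm (y.1 - y'.1) + dSet (Ω₀ \ Ω) y.1 + dSet (Ω₀ \ Ω) y'.1))) := by
  obtain ⟨δ, c, hδ, hc, H⟩ := cov120_region_sub_delta d ℓ hℓ amin aplus m2max a2min a2plus ha ha2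
  refine ⟨δ, c, hδ, hc, ?_⟩
  intro n hn a₁ m2 a₂ h1 h2 h3 h4 h5 h6 Ω Ω₀ hΩ hΩ₀ h y y'
  have h' := H n hn a₁ m2 a₂ h1 h2 h3 h4 h5 h6 Ω Ω₀ hΩ hΩ₀ h id Function.injective_id y y'
  rw [covRSub_id] at h'
  exact h'

/-- **(1.20) for a `Finset` `Λ ⊆ Ω^{(k)}` of unit sites.**
[cite: Balaban1983RegularityDecay, p. 574 (1.19)–(1.20), case A = 0] -/
theorem cov120_region_finset_delta (d ℓ : ℕ) (hℓ : 1 ≤ ℓ) (amin aplus m2max a2min a2plus : ℝ)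
    (ha : 0 < amin) (ha2 : 0 < a2min) :
    ∃ δ c : ℝ, 0 < δ ∧ 0 < c ∧ ∀ (n : ℕ), 1 ≤ n → ∀ (a₁ m2 a₂ : ℝ), amin ≤ a₁ → a₁ ≤ aplus → 0 ≤ m2 →
      m2 ≤ m2max → a2min ≤ a₂ → a₂ ≤ a2plus →
      ∀ (Ω Ω₀ : Finset (Fin (d + 1) → ℤ)), IsBlockUnion (ℓ + 1) Ω → IsBlockUnion (ℓ + 1) Ω₀ →
        ∀ (h : Ω ⊆ Ω₀) (Λ : Finset ↥Ω) (y y' : ↥Λ),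
          |(covRSub n (ℓ + 1) a₁ a₂ m2 Ω (fun y : ↥Λ => y.1))⁻¹ y y'
              - (covRSub n (ℓ + 1) a₁ a₂ m2 Ω₀ (fun y : ↥Λ => incl h y.1))⁻¹ y y'|
            ≤ c * Real.exp (-(δ * (supNorm (y.1.1 - y'.1.1)
                + dSet (Ω₀ \ Ω) y.1.1 + dSet (Ω₀ \ Ω) y'.1.1))) := by
  obtain ⟨δ, c, hδ, hc, H⟩ := cov120_region_sub_delta d ℓ hℓ amin aplus m2max a2min a2plus ha ha2
  refine ⟨δ, c, hδ, hc, ?_⟩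
  intro n hn a₁ m2 a₂ h1 h2 h3 h4 h5 h6 Ω Ω₀ hΩ hΩ₀ h Λ y y'
  exact H n hn a₁ m2 a₂ h1 h2 h3 h4 h5 h6 Ω Ω₀ hΩ hΩ₀ h (fun y : ↥Λ => y.1) Subtype.val_injective y y'

/-- non-vacuity at `d + 1 = 4`, `L = 2`, window `a_k ∈ [1/2, 2]`, `m_k² ∈ [0, 1]`, `a ∈ [1/2, 2]`: (1.20) for
every nested pair of unions of `2`-blocks and every `Finset` `Λ` of unit sites of the smaller one. -/
example : ∃ δ c : ℝ, 0 < δ ∧ 0 < c ∧ ∀ (n : ℕ), 1 ≤ n → ∀ (a₁ m2 a₂ : ℝ), (1 / 2 : ℝ) ≤ a₁ → a₁ ≤ 2 →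
    0 ≤ m2 → m2 ≤ 1 → (1 / 2 : ℝ) ≤ a₂ → a₂ ≤ 2 →
    ∀ (Ω Ω₀ : Finset (Fin (3 + 1) → ℤ)), IsBlockUnion (1 + 1) Ω → IsBlockUnion (1 + 1) Ω₀ →
      ∀ (h : Ω ⊆ Ω₀) (Λ : Finset ↥Ω) (y y' : ↥Λ),
        |(covRSub n (1 + 1) a₁ a₂ m2 Ω (fun y : ↥Λ => y.1))⁻¹ y y'
            - (covRSub n (1 + 1) a₁ a₂ m2 Ω₀ (fun y : ↥Λ => incl h y.1))⁻¹ y y'|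
          ≤ c * Real.exp (-(δ * (supNorm (y.1.1 - y'.1.1)
              + dSet (Ω₀ \ Ω) y.1.1 + dSet (Ω₀ \ Ω) y'.1.1))) :=
  cov120_region_finset_delta 3 1 le_rfl (1 / 2) 2 1 (1 / 2) 2 (by norm_num) (by norm_num)

end Cov120





end

end Literature.MathematicalPhysics.QuantumFieldTheory.Balaban1983to89.B4TwoRegion120
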